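import Literature.Analysis.FluidPDE.CompressibleEulerImplosionRates
import Literature.Analysis.FluidPDE.CompressibleEulerExactSolutionUniformBounds
import Literature.Analysis.FluidPDE.CompressibleEulerExactSolutionDensityLowerBound
import Literature.Analysis.FluidPDE.IsentropicEulerPeriodicDescent
import Literature.Analysis.FluidPDE.IsentropicEulerLiftEquations
import Literature.Analysis.FluidPDE.IsentropicEulerSpatialGlue
import Literature.Analysis.FunctionSpaces.TorusPeriodicLocalization
import Literature.Analysis.FunctionSpaces.BumpComplementLocalization
import Literature.Analysis.FunctionSpaces.TorusNearestLatticePoint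
import HarnessLib

/-!
# The periodic implosion with its rates from the Euclidean one, via finite speed of propagation
# (assembly of `CaolaboraEtAl2025_thm12_rates` modulo profile existence and local existence)

Topic `Literature/Analysis/FluidPDE`; namespace `Literature.Analysis.FluidPDE.CaolaboraEtAl2025`.
THEOREMS ONLY, no new facts (D-0026).

Cao-Labora–Gómez-Serrano–Shi–Staffilani, *Non-radial implosion for compressible Euler and
Navier–Stokes in `𝕋³` and `ℝ³`*, Camb. J. Math. 13 (2025), arXiv:2310.05325 (held text
`paper-arxiv-2310.05325`), Remark 1.5, p. 7: "the Euler result with periodic boundary conditions and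
radially symmetric perturbation can be easily deduced from the non-periodic one ([MRRS], [BCG]) via
finite speed of propagation". This file carries out that deduction for the UNPERTURBED profile of
Buckmaster–Cao-Labora–Gómez-Serrano (the named fact `BuckmasterCaolaboraGomezserrano2025_thm11_monatomic`,
`γ = 5/3`), all the way to the five clauses of the named fact `CaolaboraEtAl2025_thm12_rates`
(`CompressibleEulerImplosionRates.lean`), GIVEN a quantitative local existence theorem for smooth
periodic data (Majda 1984, Ch. 2, Thm 2.1 — "`T` depends on `s`, `‖u₀‖_s` and `G₁`" — with Cor. 1,
`C^∞` persistence), taken as an explicit hypothesis in the form the tree's vocabulary allows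
(`IsIsentropicEulerSolution`, `Torus.IsSmooth`, Mathlib `iteratedFDeriv` of the periodic lift):

  (LWP) for all `B`, `m > 0` there is `τ > 0` such that all smooth data `(ρ₀, u₀)` on `𝕋³` with
  `ρ₀ ≥ m` and `‖∇ⁿρ₀‖_∞, ‖∇ⁿu₀‖_∞ ≤ B` (`n ≤ 4`) launch a classical isentropic solution on `[0, τ)`.

Construction (blow-up time `T` small, unit period, cores at the lattice points):
* the exact self-similar solution `E_T = (ρ_T, u_T)` of `CompressibleEulerExactSelfSimilarImplosion.lean`
  near each lattice point (recentred, `TorusNearestLatticePoint.lean`);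
* an AUXILIARY periodic classical solution `(ρ', u')` given by (LWP) from the smooth periodic data
  obtained by filling the cores of `E_T(0, ·)` (`BumpComplementLocalization.lean`) and periodising
  (`TorusPeriodicLocalization.lean`); its data have `T`-UNIFORM `C⁴` bounds and density floor
  (`CompressibleEulerExactSolutionUniformBounds.lean`: eq. (1.6) and `S̄ ≳ ⟨R⟩^{1−r}` transported to
  the exact solution), so its existence time `τ` does not shrink as `T → 0`, and `T < τ`;
* identification of `(ρ', u')` with `E_T` on the annuli `9/64 < |x − k| < 15/64` for `t < T` by the
  domain-of-dependence theorem (Dafermos 2005, Thm 5.2.1; `lift_eq_exact_on_cone_uniform`, acoustic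
  radius `M T^{1/r} ≤ 1/64`);
* spatial gluing (`IsentropicEulerSpatialGlue.lean`), descent to `𝕋³` (`IsentropicEulerPeriodicDescent.lean`);
* the rate clauses: Type I and all-orders bounds in the exact region from `typeI_of_profile`,
  `exactSolution_iteratedFDeriv_le`; boundedness of everything in the auxiliary region (compact
  `[0, T] × 𝕋³`); density floor from `exactSolution_soundSpeed_lower` and compactness; the core law
  is the exact one, `ρ(t, 0) = (S̄(0)/(3r))³ (T−t)^{−3(1−1/r)}`.

Main results: `rates_of_thm11_monatomic_of_lwp` (`X ∧ (LWP) → CaolaboraEtAl2025_thm12_rates`).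
[cite: CaolaboraEtAl2025, Thm 1.2 p. 6, Rem 1.4 p. 6, Rem 1.5 p. 7; §1.3 p. 5; eq. (1.6) p. 6]
[cite: Dafermos2005, §5.2, Thm 5.2.1] [cite: Majda1984, Ch. 2 Thm 2.1 + Cor. 1]
-/

noncomputable section

open Set Filter Metric
open scoped Topology ContDiff

namespace Literature.Analysis.FluidPDE

open Literature.MathematicalPhysics.KineticTheory (T3 V3)
open Literature.Analysis.FunctionSpaces

namespace CaolaboraEtAl2025

/-! ### Generic helpers -/

section Helpers

variable {F : Type*} [NormedAddCommGroup F] [NormedSpace ℝ F]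

/-- `‖T‖ ≤ ∑_l ‖T e_l‖` for a continuous linear map on `ℝ³`. [folklore] -/
theorem opNorm_le_sum_apply_single (L : V3 →L[ℝ] F) :
    ‖L‖ ≤ ∑ l, ‖L (EuclideanSpace.single l (1 : ℝ))‖ := by
  refine ContinuousLinearMap.opNorm_le_bound _ (Finset.sum_nonneg fun l _ => norm_nonneg _) fun v => ?_
  have hv : v = ∑ l, v l • (EuclideanSpace.single l (1 : ℝ) : V3) := by
    conv_lhs => rw [← (EuclideanSpace.basisFun (Fin 3) ℝ).sum_repr v]
    simp
  calc ‖L v‖ = ‖∑ l, v l • L (EuclideanSpace.single l (1 : ℝ))‖ := by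
        conv_lhs => rw [hv]
        simp [map_sum, map_smul]
    _ ≤ ∑ l, ‖v l • L (EuclideanSpace.single l (1 : ℝ))‖ := norm_sum_le _ _
    _ ≤ ∑ l, ‖v‖ * ‖L (EuclideanSpace.single l (1 : ℝ))‖ := Finset.sum_le_sum fun l _ => by
        rw [norm_smul]
        exact mul_le_mul_of_nonneg_right (by simpa using PiLp.norm_apply_le v l) (norm_nonneg _)
    _ = (∑ l, ‖L (EuclideanSpace.single l (1 : ℝ))‖) * ‖v‖ := by
        rw [Finset.sum_mul]; exact Finset.sum_congr rfl fun l _ => mul_comm _ _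

/-- `‖D^{n+1}(lift g)(y)‖ ≤ ∑_l ‖Dⁿ(lift ∂_l g)(y)‖` for smooth `g` on `𝕋³` (re-derived from
`CP25.norm_iteratedFDeriv_succ_le_sum_partialDeriv` to keep the import cone small). [folklore] -/
theorem norm_iteratedFDeriv_lift_succ_le {g : T3 → F} (hg : Torus.IsSmooth g) (n : ℕ) (y : V3) :
    ‖iteratedFDeriv ℝ (n + 1) (Torus.lift g) y‖ ≤
      ∑ l, ‖iteratedFDeriv ℝ n (Torus.lift (Torus.partialDeriv l g)) y‖ := by
  have h1 : Torus.IsContDiff 1 g := hg.isContDiff (by simp)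
  have hD : ContDiff ℝ ∞ (fderiv ℝ (Torus.lift g)) := hg.fderiv_right (by exact_mod_cast le_top)
  rw [← norm_iteratedFDeriv_fderiv]
  set A := iteratedFDeriv ℝ n (fderiv ℝ (Torus.lift g)) y with hA
  have hl : ∀ l, Torus.lift (Torus.partialDeriv l g) =
      fun z => fderiv ℝ (Torus.lift g) z (EuclideanSpace.single l (1 : ℝ)) :=
    fun l => Torus.lift_lineDeriv h1 _
  have happ : ∀ (l : Fin 3) (m : Fin n → V3),
      A m (EuclideanSpace.single l (1 : ℝ)) =
        iteratedFDeriv ℝ n (Torus.lift (Torus.partialDeriv l g)) y m := by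
    intro l m
    rw [hl l, show (fun z => fderiv ℝ (Torus.lift g) z (EuclideanSpace.single l (1 : ℝ))) =
        (ContinuousLinearMap.apply ℝ F (EuclideanSpace.single l (1 : ℝ))) ∘ fderiv ℝ (Torus.lift g)
        from rfl,
      ContinuousLinearMap.iteratedFDeriv_comp_left _ hD.contDiffAt (by exact_mod_cast le_top)]
    rfl
  refine ContinuousMultilinearMap.opNorm_le_bound (Finset.sum_nonneg fun l _ => norm_nonneg _)
    fun m => ?_
  calc ‖A m‖ ≤ ∑ l, ‖A m (EuclideanSpace.single l (1 : ℝ))‖ := opNorm_le_sum_apply_single _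
    _ = ∑ l, ‖iteratedFDeriv ℝ n (Torus.lift (Torus.partialDeriv l g)) y m‖ :=
        Finset.sum_congr rfl fun l _ => by rw [happ]
    _ ≤ ∑ l, ‖iteratedFDeriv ℝ n (Torus.lift (Torus.partialDeriv l g)) y‖ * ∏ i, ‖m i‖ :=
        Finset.sum_le_sum fun l _ => ContinuousMultilinearMap.le_opNorm _ _
    _ = (∑ l, ‖iteratedFDeriv ℝ n (Torus.lift (Torus.partialDeriv l g)) y‖) * ∏ i, ‖m i‖ := by
        rw [Finset.sum_mul]

/-- **All space derivatives of a jointly smooth field on `𝕋³` are bounded on compact time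
sets**: `‖∇ⁿ(lift (v t))(y)‖ ≤ C` for `t ∈ K`, `K` compact inside the time set, all `y ∈ ℝ³`
(induction on `n` through the partial derivatives, which are jointly smooth). [folklore] -/
theorem exists_bound_iteratedFDeriv_lift {S K : Set ℝ} (hS : UniqueDiffOn ℝ S) (hK : IsCompact K)
    (hKS : K ⊆ S) (n : ℕ) :
    ∀ {v : ℝ → T3 → F}, Torus.IsSmoothSpaceTimeOn S v →
      ∃ C : ℝ, ∀ t ∈ K, ∀ y : V3, ‖iteratedFDeriv ℝ n (Torus.lift (v t)) y‖ ≤ C := by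
  induction n with
  | zero =>
    intro v hv
    obtain ⟨C, hC⟩ := hv.exists_norm_le_of_isCompact hK hKS
    exact ⟨C, fun t ht y => by rw [norm_iteratedFDeriv_zero, Torus.lift_apply]; exact hC t ht _⟩
  | succ n ih =>
    intro v hv
    have hl : ∀ l : Fin 3, ∃ C : ℝ, ∀ t ∈ K, ∀ y : V3,
        ‖iteratedFDeriv ℝ n (Torus.lift (Torus.partialDeriv l (v t))) y‖ ≤ C :=
      fun l => ih (hv.partialDeriv hS l)
    choose C hC using hl
    refine ⟨∑ l, C l, fun t ht y => ?_⟩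
    have hsm : Torus.IsSmooth (v t) := hv.isSmooth_slice (hKS ht)
    exact (norm_iteratedFDeriv_lift_succ_le hsm n y).trans (Finset.sum_le_sum fun l _ => hC l t ht y)

/-- **Pointwise Leibniz bound**: bounds `A`, `B` for the derivatives of orders `≤ n` of two
smooth real functions at a point bound those of the product by `2ⁿ A B`. [folklore] -/
theorem norm_iteratedFDeriv_mul_le_of_le {E : Type*} [NormedAddCommGroup E] [NormedSpace ℝ E]
    {f g : E → ℝ} (hf : ContDiff ℝ ∞ f) (hg : ContDiff ℝ ∞ g) {x : E} {n : ℕ} {A B : ℝ}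
    (hA : ∀ i, i ≤ n → ‖iteratedFDeriv ℝ i f x‖ ≤ A) (hB : ∀ i, i ≤ n → ‖iteratedFDeriv ℝ i g x‖ ≤ B) :
    ∀ i, i ≤ n → ‖iteratedFDeriv ℝ i (fun y => f y * g y) x‖ ≤ 2 ^ n * A * B := by
  have hA0 : 0 ≤ A := (norm_nonneg _).trans (hA 0 (Nat.zero_le _))
  have hB0 : 0 ≤ B := (norm_nonneg _).trans (hB 0 (Nat.zero_le _))
  intro i hi
  have h := norm_iteratedFDeriv_mul_le (𝕜 := ℝ) hf hg x (n := i) (by exact_mod_cast le_top)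
  refine h.trans ?_
  calc ∑ j ∈ Finset.range (i + 1), (i.choose j : ℝ) * ‖iteratedFDeriv ℝ j f x‖ *
        ‖iteratedFDeriv ℝ (i - j) g x‖
      ≤ ∑ j ∈ Finset.range (i + 1), (i.choose j : ℝ) * A * B := by
        refine Finset.sum_le_sum fun j hj => ?_
        have hji : j ≤ i := Nat.lt_succ_iff.1 (Finset.mem_range.1 hj)
        have h1 := hA j (hji.trans hi)
        have h2 := hB (i - j) ((Nat.sub_le i j).trans hi)
        have h3 : ‖iteratedFDeriv ℝ j f x‖ * ‖iteratedFDeriv ℝ (i - j) g x‖ ≤ A * B :=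
          mul_le_mul h1 h2 (norm_nonneg _) hA0
        calc (i.choose j : ℝ) * ‖iteratedFDeriv ℝ j f x‖ * ‖iteratedFDeriv ℝ (i - j) g x‖
            = (i.choose j : ℝ) * (‖iteratedFDeriv ℝ j f x‖ * ‖iteratedFDeriv ℝ (i - j) g x‖) := by ring
          _ ≤ (i.choose j : ℝ) * (A * B) := mul_le_mul_of_nonneg_left h3 (Nat.cast_nonneg _)
          _ = (i.choose j : ℝ) * A * B := by ring
    _ = 2 ^ i * A * B := by
        rw [← Finset.sum_mul, ← Finset.sum_mul]
        congr 2
        have h := Nat.sum_range_choose i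
        exact_mod_cast h
    _ ≤ 2 ^ n * A * B := by
        have h2 : (2 : ℝ) ^ i ≤ 2 ^ n := pow_le_pow_right₀ (by norm_num) hi
        have := mul_le_mul_of_nonneg_right h2 (mul_nonneg hA0 hB0)
        nlinarith [this]

/-- Locality of torus partial derivatives, seen upstairs: if `f ∘ proj = g ∘ proj` near `z` then
`∂ᵢ f (proj z) = ∂ᵢ g (proj z)`. [folklore] -/
theorem partialDeriv_congr_of_eventuallyEq {f g : T3 → F} {z : V3}
    (h : ∀ᶠ w in 𝓝 z, f (Torus.proj w) = g (Torus.proj w)) (i : Fin 3) :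
    Torus.partialDeriv i f (Torus.proj z) = Torus.partialDeriv i g (Torus.proj z) := by
  change deriv (fun s : ℝ => f (Torus.proj z + Torus.proj (s • EuclideanSpace.single i (1 : ℝ)))) 0 =
    deriv (fun s : ℝ => g (Torus.proj z + Torus.proj (s • EuclideanSpace.single i (1 : ℝ)))) 0
  apply Filter.EventuallyEq.deriv_eq
  have hc : Continuous fun s : ℝ => z + s • (EuclideanSpace.single i (1 : ℝ) : V3) := by fun_prop
  have ht : Tendsto (fun s : ℝ => z + s • (EuclideanSpace.single i (1 : ℝ) : V3)) (𝓝 0) (𝓝 z) := by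
    have := hc.tendsto 0
    simpa using this
  filter_upwards [ht.eventually h] with s hs
  rw [← Torus.proj_add, hs]

/-- Slices of a jointly smooth upstairs field are differentiable in time within the time set.
[folklore] -/
theorem differentiableWithinAt_time_slice {G : ℝ → V3 → F} {S : Set ℝ}
    (hG : ContDiffOn ℝ ∞ (fun p : ℝ × V3 => G p.1 p.2) (S ×ˢ univ)) {t : ℝ} (ht : t ∈ S) (z : V3) :
    DifferentiableWithinAt ℝ (fun s => G s z) S t := by
  have h1 : DifferentiableWithinAt ℝ (fun p : ℝ × V3 => G p.1 p.2) (S ×ˢ univ) (t, z) :=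
    hG.differentiableOn (by simp) (t, z) (mk_mem_prod ht (mem_univ z))
  have h2 : DifferentiableWithinAt ℝ (fun s : ℝ => ((s, z) : ℝ × V3)) S t :=
    (differentiableAt_id.prodMk (differentiableAt_const z)).differentiableWithinAt
  exact h1.comp t h2 fun s hs => mk_mem_prod hs (mem_univ z)

/-- Slices of an upstairs field jointly smooth on the open set `{t < T} × ℝ³` are differentiable in
time (two-sided) at every `t < T`. [folklore] -/
theorem hasDerivAt_time_slice {G : ℝ → V3 → F} {T : ℝ}
    (hG : ContDiffOn ℝ ∞ (fun p : ℝ × V3 => G p.1 p.2) {p | p.1 < T}) {t : ℝ} (ht : t < T) (z : V3) :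
    HasDerivAt (fun s => G s z) (deriv (fun s => G s z) t) t := by
  have hopen : IsOpen {p : ℝ × V3 | p.1 < T} := isOpen_lt continuous_fst continuous_const
  have h1 : DifferentiableAt ℝ (fun p : ℝ × V3 => G p.1 p.2) (t, z) :=
    (hG.differentiableOn (by simp)).differentiableAt (hopen.mem_nhds ht)
  have h2 : DifferentiableAt ℝ (fun s : ℝ => ((s, z) : ℝ × V3)) t :=
    differentiableAt_id.prodMk (differentiableAt_const z)
  exact (h1.comp t h2).hasDerivAt

/-- Slices of an upstairs field jointly smooth on the open set `{t < T} × ℝ³` are smooth in space.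
[folklore] -/
theorem contDiff_space_slice {G : ℝ → V3 → F} {T : ℝ}
    (hG : ContDiffOn ℝ ∞ (fun p : ℝ × V3 => G p.1 p.2) {p | p.1 < T}) {t : ℝ} (ht : t < T) :
    ContDiff ℝ ∞ (G t) := by
  change ContDiff ℝ ∞ ((fun p : ℝ × V3 => G p.1 p.2) ∘ fun y : V3 => (t, y))
  exact hG.comp_contDiff (contDiff_prodMk_right t) fun y => ht

end Helpers

/-! ### The auxiliary periodic data, with bounds uniform in the blow-up time -/

section Data

variable {r : ℝ} {U S : ℝ → ℝ} {Ub : V3 → V3} {Sb : V3 → ℝ}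

/-- Positivity of a filled, periodised density from local information: if `m ≤ 1` and
`m ≤ F y` for `|y| < 3/8`, then `m ≤ 1 + perSum(χ • (F − 1))` for the bump `χ` of radii
`1/4 < 3/8`. [folklore] -/
theorem le_localize_of_ball (χ : ContDiffBump (0 : V3)) (hχ : χ.rOut = 3 / 8) {F : V3 → ℝ} {m : ℝ}
    (hm : m ≤ 1) (hF : ∀ y, ‖y‖ < 3 / 8 → m ≤ F y) (x : V3) :
    m ≤ 1 + Torus.perSum (fun y => χ y • (F y - 1)) x := by
  obtain ⟨k, hk⟩ := Torus.exists_perSum_eqOn_ball (χ := χ) F 1 x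
  rw [hk x (mem_ball_self (by rw [hχ]; norm_num)), smul_eq_mul]
  have h0 := χ.nonneg' (x - Torus.latticeVec k)
  have h1 := χ.le_one (x := x - Torus.latticeVec k)
  by_cases hx : ‖x - Torus.latticeVec k‖ < 3 / 8
  · nlinarith [hF _ hx]
  · have hz : χ (x - Torus.latticeVec k) = 0 := by
      refine χ.zero_of_le_dist ?_
      rw [dist_zero_right, hχ]
      exact not_lt.1 hx
    rw [hz]; linarith

/-- **The far field of the exact data, uniformly in the blow-up time.** For profiles as in the
vendored fact (`1 < r < 2`, `S̄ > 0`) there are `T₁ > 0`, `A₀ ≥ 0`, `s₀ > 0` such that for every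
blow-up time `0 < T ≤ T₁` the exact data `(ρ_T, u_T)(0, ·)` are smooth and satisfy, OFF the core
`|y| ≥ 1/16`: `‖∇ⁿu_T(0,·)(y)‖, ‖∇ⁿρ_T(0,·)(y)‖ ≤ A₀` for `n ≤ 4`, and `ρ_T(0, y) ≥ s₀` for
`1/16 ≤ |y| < 3/8`. [cite: CaolaboraEtAl2025, eq. (1.6) p. 6 (both bounds), §1.3 p. 5] -/
theorem exists_farField_data_bounds (hr1 : 1 < r) (hr2 : r < 2)
    (hU : ContDiff ℝ ∞ fun y : V3 => (U ‖y‖ / ‖y‖) • y) (hS : ContDiff ℝ ∞ fun y : V3 => S ‖y‖)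
    (hode : ∀ ζ : ℝ, 0 < ζ →
      (r - 1) * U ζ + (ζ + U ζ) * deriv U ζ + 1 / 3 * S ζ * deriv S ζ = 0 ∧
      (r - 1) * S ζ + (ζ + U ζ) * deriv S ζ + 1 / 3 * S ζ * (deriv U ζ + 2 * U ζ / ζ) = 0)
    (hSpos : ∀ ζ : ℝ, 0 ≤ ζ → 0 < S ζ)
    (hlimU : Tendsto (fun ζ => U ζ / ζ) atTop (𝓝 0))
    (hlimS : Tendsto (fun ζ => S ζ / ζ) atTop (𝓝 0))
    (hUb : Ub = fun y : V3 => (U ‖y‖ / ‖y‖) • y) (hSb : Sb = fun y : V3 => S ‖y‖) :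
    ∃ T₁ A₀ s₀ : ℝ, 0 < T₁ ∧ 0 ≤ A₀ ∧ 0 < s₀ ∧ ∀ (T : ℝ) (u : ℝ → V3 → V3) (σ ρ : ℝ → V3 → ℝ),
      0 < T → T ≤ T₁ →
      (∀ t x, u t x = (r⁻¹ * (T - t) ^ (1 / r - 1)) • Ub ((T - t) ^ (-1 / r) • x)) →
      (∀ t x, σ t x = (r⁻¹ * (T - t) ^ (1 / r - 1)) * Sb ((T - t) ^ (-1 / r) • x)) →
      (∀ t x, ρ t x = (σ t x / 3) ^ 3) →
      ContDiff ℝ ∞ (u 0) ∧ ContDiff ℝ ∞ (ρ 0) ∧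
      (∀ n : ℕ, n ≤ 4 → ∀ y : V3, 1 / 16 ≤ ‖y‖ →
        ‖iteratedFDeriv ℝ n (u 0) y‖ ≤ A₀ ∧ ‖iteratedFDeriv ℝ n (ρ 0) y‖ ≤ A₀) ∧
      (∀ y : V3, 1 / 16 ≤ ‖y‖ → ‖y‖ < 3 / 8 → s₀ ≤ ρ 0 y) := by
  have hr0 : 0 < r := by linarith
  have hUb' : ContDiff ℝ ∞ Ub := hUb ▸ hU
  have hSb' : ContDiff ℝ ∞ Sb := hSb ▸ hS
  -- (1) `T`-uniform far-field bounds for all orders `≤ N`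
  have hFF : ∀ N : ℕ, ∃ R C : ℝ, 0 < R ∧ 0 ≤ C ∧ ∀ n, n ≤ N →
      ∀ (T : ℝ) (u : ℝ → V3 → V3) (σ : ℝ → V3 → ℝ),
      (∀ t x, u t x = (r⁻¹ * (T - t) ^ (1 / r - 1)) • Ub ((T - t) ^ (-1 / r) • x)) →
      (∀ t x, σ t x = (r⁻¹ * (T - t) ^ (1 / r - 1)) * Sb ((T - t) ^ (-1 / r) • x)) →
      ∀ t, t < T → ∀ x : V3, R * (T - t) ^ (1 / r) ≤ ‖x‖ →
        ‖iteratedFDeriv ℝ n (u t) x‖ ≤ C * ‖x‖ ^ (1 - r - n) ∧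
          ‖iteratedFDeriv ℝ n (σ t) x‖ ≤ C * ‖x‖ ^ (1 - r - n) := by
    intro N
    induction N with
    | zero =>
      obtain ⟨R, C, hR, h⟩ := farField_iteratedFDeriv_uniform hr1 hr2 hU hS hode hlimU hlimS hUb hSb 0
      refine ⟨R, max C 0, hR, le_max_right _ _, fun n hn T u σ hu hσ t ht x hx => ?_⟩
      obtain rfl : n = 0 := Nat.le_zero.1 hn
      have h1 := h T u σ hu hσ t ht x hx
      have hp : 0 ≤ ‖x‖ ^ (1 - r - ((0 : ℕ) : ℝ)) := Real.rpow_nonneg (norm_nonneg _) _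
      exact ⟨h1.1.trans (mul_le_mul_of_nonneg_right (le_max_left _ _) hp),
        h1.2.trans (mul_le_mul_of_nonneg_right (le_max_left _ _) hp)⟩
    | succ N ih =>
      obtain ⟨R, C, hR, hC0, h⟩ := ih
      obtain ⟨R', C', hR', h'⟩ :=
        farField_iteratedFDeriv_uniform hr1 hr2 hU hS hode hlimU hlimS hUb hSb (N + 1)
      refine ⟨max R R', max C C', lt_max_of_lt_left hR, le_max_of_le_left hC0,
        fun n hn T u σ hu hσ t ht x hx => ?_⟩
      have hl : 0 ≤ (T - t) ^ (1 / r) := Real.rpow_nonneg (sub_pos.2 ht).le _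
      have hp : 0 ≤ ‖x‖ ^ (1 - r - (n : ℝ)) := Real.rpow_nonneg (norm_nonneg _) _
      rcases Nat.lt_or_eq_of_le hn with hlt | rfl
      · have hxR : R * (T - t) ^ (1 / r) ≤ ‖x‖ :=
          (mul_le_mul_of_nonneg_right (le_max_left _ _) hl).trans hx
        have h1 := h n (Nat.lt_succ_iff.1 hlt) T u σ hu hσ t ht x hxR
        exact ⟨h1.1.trans (mul_le_mul_of_nonneg_right (le_max_left _ _) hp),
          h1.2.trans (mul_le_mul_of_nonneg_right (le_max_left _ _) hp)⟩
      · have hxR : R' * (T - t) ^ (1 / r) ≤ ‖x‖ :=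
          (mul_le_mul_of_nonneg_right (le_max_right _ _) hl).trans hx
        have h1 := h' T u σ hu hσ t ht x hxR
        exact ⟨h1.1.trans (mul_le_mul_of_nonneg_right (le_max_right _ _) hp),
          h1.2.trans (mul_le_mul_of_nonneg_right (le_max_right _ _) hp)⟩
  obtain ⟨R, C, hR, hC0, hfar⟩ := hFF 4
  -- (2) the `T`-uniform far-field floor
  obtain ⟨R₀, c₀, hR₀, hc₀, hlow⟩ :=
    farField_soundSpeed_lower_uniform hr1 hr2 hU hS hode hSpos hlimU hlimS hSb
  -- (3) the threshold `T₁`: `R T^{1/r} ≤ 1/16` and `R₀ T^{1/r} ≤ 1/16` for `T ≤ T₁`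
  obtain ⟨T₁, hT₁⟩ : ∃ T₁ : ℝ, T₁ = min ((1 / (16 * R)) ^ r) ((1 / (16 * R₀)) ^ r) := ⟨_, rfl⟩
  have hT₁pos : 0 < T₁ := by
    rw [hT₁]
    exact lt_min (Real.rpow_pos_of_pos (by positivity) _) (Real.rpow_pos_of_pos (by positivity) _)
  have hsmall : ∀ {T : ℝ}, 0 < T → T ≤ T₁ → R * T ^ (1 / r) ≤ 1 / 16 ∧ R₀ * T ^ (1 / r) ≤ 1 / 16 := by
    intro T hT hTT₁
    have key : ∀ {Q : ℝ}, 0 < Q → T ≤ (1 / (16 * Q)) ^ r → Q * T ^ (1 / r) ≤ 1 / 16 := by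
      intro Q hQ hTQ
      have h1 : T ^ (1 / r) ≤ 1 / (16 * Q) := by
        have h := Real.rpow_le_rpow hT.le hTQ (by positivity : (0 : ℝ) ≤ 1 / r)
        rw [one_div r, Real.rpow_rpow_inv (by positivity) hr0.ne'] at h
        rwa [one_div r]
      calc Q * T ^ (1 / r) ≤ Q * (1 / (16 * Q)) := mul_le_mul_of_nonneg_left h1 hQ.le
        _ = 1 / 16 := by field_simp
    rw [hT₁] at hTT₁
    exact ⟨key hR (hTT₁.trans (min_le_left _ _)), key hR₀ (hTT₁.trans (min_le_right _ _))⟩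
  -- (4) the constants
  obtain ⟨A₀, hA₀⟩ : ∃ A₀ : ℝ, A₀ = C * (1 / 16 : ℝ) ^ (1 - r - 4 : ℝ) := ⟨_, rfl⟩
  have hA₀0 : 0 ≤ A₀ := by rw [hA₀]; exact mul_nonneg hC0 (Real.rpow_nonneg (by norm_num) _)
  obtain ⟨Aρ, hAρ⟩ : ∃ Aρ : ℝ, Aρ = 1 / 27 * (2 ^ 4 * (2 ^ 4 * A₀ * A₀) * A₀) := ⟨_, rfl⟩
  have hAρ0 : 0 ≤ Aρ := by rw [hAρ]; positivity
  obtain ⟨s₀, hs₀⟩ : ∃ s₀ : ℝ, s₀ = c₀ * (3 / 8 : ℝ) ^ (1 - r) := ⟨_, rfl⟩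
  have hs₀pos : 0 < s₀ := by rw [hs₀]; exact mul_pos hc₀ (Real.rpow_pos_of_pos (by norm_num) _)
  refine ⟨T₁, max A₀ Aρ, (s₀ / 3) ^ 3, hT₁pos, le_max_of_le_left hA₀0, by positivity,
    fun T u σ ρ hT hTT₁ hu hσ hρ => ?_⟩
  obtain ⟨hRT, hR₀T⟩ := hsmall hT hTT₁
  -- the data of the exact solution at `t = 0`
  have hσ0 : ContDiff ℝ ∞ (σ 0) := by
    have hf : σ 0 = fun x => (r⁻¹ * (T - 0) ^ (1 / r - 1)) * Sb ((T - 0) ^ (-1 / r) • x) :=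
      funext fun x => hσ 0 x
    have h2 : ContDiff ℝ ∞ fun x : V3 => Sb ((T - 0) ^ (-1 / r) • x) :=
      hSb'.comp (contDiff_const_smul _)
    rw [hf]
    exact contDiff_const.mul h2
  have hu0 : ContDiff ℝ ∞ (u 0) := by
    have hf : u 0 = fun x => (r⁻¹ * (T - 0) ^ (1 / r - 1)) • Ub ((T - 0) ^ (-1 / r) • x) :=
      funext fun x => hu 0 x
    have h2 : ContDiff ℝ ∞ fun x : V3 => Ub ((T - 0) ^ (-1 / r) • x) :=
      hUb'.comp (contDiff_const_smul _)
    have h3 : ContDiff ℝ ∞ fun x : V3 => (r⁻¹ * (T - 0) ^ (1 / r - 1)) • Ub ((T - 0) ^ (-1 / r) • x) :=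
      h2.const_smul _
    rw [hf]
    exact h3
  have hρ0f : ρ 0 = fun y => (1 / 27 : ℝ) • (σ 0 y * σ 0 y * σ 0 y) := by
    funext y; rw [hρ 0 y, smul_eq_mul]; ring
  have hσ3 : ContDiff ℝ ∞ fun y => σ 0 y * σ 0 y * σ 0 y := (hσ0.mul hσ0).mul hσ0
  have hρ0 : ContDiff ℝ ∞ (ρ 0) := by
    have h3 : ContDiff ℝ ∞ fun y => (1 / 27 : ℝ) • (σ 0 y * σ 0 y * σ 0 y) := hσ3.const_smul _
    rw [hρ0f]; exact h3
  -- far-field bounds at `t = 0` for `|y| ≥ 1/16`, orders `≤ 4`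
  have hfar0 : ∀ n, n ≤ 4 → ∀ y : V3, 1 / 16 ≤ ‖y‖ →
      ‖iteratedFDeriv ℝ n (u 0) y‖ ≤ A₀ ∧ ‖iteratedFDeriv ℝ n (σ 0) y‖ ≤ A₀ := by
    intro n hn y hy
    have hy0 : 0 < ‖y‖ := lt_of_lt_of_le (by norm_num) hy
    have hxR : R * (T - 0) ^ (1 / r) ≤ ‖y‖ := by rw [sub_zero]; exact hRT.trans hy
    have h1 := hfar n hn T u σ hu hσ 0 hT y hxR
    have hexp : (1 - r - (n : ℝ)) ≤ 0 := by
      have : (0 : ℝ) ≤ n := Nat.cast_nonneg n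
      linarith
    have hpow : ‖y‖ ^ (1 - r - (n : ℝ)) ≤ (1 / 16 : ℝ) ^ (1 - r - 4 : ℝ) := by
      have hn' : (n : ℝ) ≤ 4 := by exact_mod_cast hn
      calc ‖y‖ ^ (1 - r - (n : ℝ)) ≤ (1 / 16 : ℝ) ^ (1 - r - (n : ℝ)) :=
            Real.rpow_le_rpow_of_nonpos (by norm_num) hy hexp
        _ ≤ (1 / 16 : ℝ) ^ (1 - r - 4 : ℝ) :=
            Real.rpow_le_rpow_of_exponent_ge (by norm_num) (by norm_num) (by linarith)
    have hb : C * ‖y‖ ^ (1 - r - (n : ℝ)) ≤ A₀ := by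
      rw [hA₀]; exact mul_le_mul_of_nonneg_left hpow hC0
    exact ⟨h1.1.trans hb, h1.2.trans hb⟩
  -- hence for `ρ(0) = σ(0)³/27`
  have hfarρ : ∀ n, n ≤ 4 → ∀ y : V3, 1 / 16 ≤ ‖y‖ → ‖iteratedFDeriv ℝ n (ρ 0) y‖ ≤ Aρ := by
    intro n hn y hy
    have hAσ : ∀ i, i ≤ 4 → ‖iteratedFDeriv ℝ i (σ 0) y‖ ≤ A₀ := fun i hi => (hfar0 i hi y hy).2
    have h2 := norm_iteratedFDeriv_mul_le_of_le hσ0 hσ0 hAσ hAσ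
    have h3 := norm_iteratedFDeriv_mul_le_of_le (hσ0.mul hσ0) hσ0 h2 hAσ n hn
    rw [hρ0f, iteratedFDeriv_const_smul_apply' ((hσ3.contDiffAt).of_le (by exact_mod_cast le_top)),
      norm_smul, Real.norm_eq_abs, abs_of_pos (by norm_num : (0 : ℝ) < 1 / 27), hAρ]
    exact mul_le_mul_of_nonneg_left h3 (by norm_num)
  refine ⟨hu0, hρ0, fun n hn y hy => ⟨(hfar0 n hn y hy).1.trans (le_max_left _ _),
    (hfarρ n hn y hy).trans (le_max_right _ _)⟩, fun y hy hy' => ?_⟩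
  -- far-field floor at `t = 0` on `1/16 ≤ |y| < 3/8`
  have hy0 : 0 < ‖y‖ := lt_of_lt_of_le (by norm_num) hy
  have hxR : R₀ * (T - 0) ^ (1 / r) ≤ ‖y‖ := by rw [sub_zero]; exact hR₀T.trans hy
  have h1 := hlow T σ hσ 0 hT y hxR
  have h2 : s₀ ≤ c₀ * ‖y‖ ^ (1 - r) := by
    rw [hs₀]
    exact mul_le_mul_of_nonneg_left (Real.rpow_le_rpow_of_nonpos hy0 hy'.le (by linarith)) hc₀.le
  have h3 : s₀ / 3 ≤ σ 0 y / 3 := by linarith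
  rw [hρ 0 y]
  exact pow_le_pow_left₀ (by positivity) h3 3
set_option maxHeartbeats 400000 in -- buildfix (bf3-g26): 160k/180k FAIL, 200k PASS at accept time; line-neutral budget line
/-- **The auxiliary data.** For profiles as in the vendored fact (`1 < r < 2`, `S̄ > 0`) there are
`T₁ > 0`, `B` and `m > 0` such that for every blow-up time `0 < T ≤ T₁` the exact self-similar
data `(ρ_T, u_T)(0, ·)` admit smooth `ℤ³`-PERIODIC fields `(D_ρ, D_u)` on `ℝ³` which AGREE with
them on the annulus `1/8 ≤ |y| ≤ 1/4`, with `D_ρ ≥ m` and `‖∇ⁿD_ρ‖, ‖∇ⁿD_u‖ ≤ B` everywhere for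
`n ≤ 4` — INDEPENDENTLY of `T` (cores `|y − k| < 1/8` filled by a constant state, far field
`|y − k| ≥ 3/8` constant; the far field of the exact data is `T`-uniformly smooth and bounded
below by eq. (1.6)). [cite: CaolaboraEtAl2025, Rem 1.5 p. 7; eq. (1.6) p. 6] -/
theorem exists_auxData (hr1 : 1 < r) (hr2 : r < 2)
    (hU : ContDiff ℝ ∞ fun y : V3 => (U ‖y‖ / ‖y‖) • y) (hS : ContDiff ℝ ∞ fun y : V3 => S ‖y‖)
    (hode : ∀ ζ : ℝ, 0 < ζ →
      (r - 1) * U ζ + (ζ + U ζ) * deriv U ζ + 1 / 3 * S ζ * deriv S ζ = 0 ∧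
      (r - 1) * S ζ + (ζ + U ζ) * deriv S ζ + 1 / 3 * S ζ * (deriv U ζ + 2 * U ζ / ζ) = 0)
    (hSpos : ∀ ζ : ℝ, 0 ≤ ζ → 0 < S ζ)
    (hlimU : Tendsto (fun ζ => U ζ / ζ) atTop (𝓝 0))
    (hlimS : Tendsto (fun ζ => S ζ / ζ) atTop (𝓝 0))
    (hUb : Ub = fun y : V3 => (U ‖y‖ / ‖y‖) • y) (hSb : Sb = fun y : V3 => S ‖y‖) :
    ∃ T₁ B m : ℝ, 0 < T₁ ∧ 0 < m ∧ ∀ (T : ℝ) (u : ℝ → V3 → V3) (σ ρ : ℝ → V3 → ℝ),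
      0 < T → T ≤ T₁ →
      (∀ t x, u t x = (r⁻¹ * (T - t) ^ (1 / r - 1)) • Ub ((T - t) ^ (-1 / r) • x)) →
      (∀ t x, σ t x = (r⁻¹ * (T - t) ^ (1 / r - 1)) * Sb ((T - t) ^ (-1 / r) • x)) →
      (∀ t x, ρ t x = (σ t x / 3) ^ 3) →
      ∃ (Dρ : V3 → ℝ) (Du : V3 → V3), ContDiff ℝ ∞ Dρ ∧ ContDiff ℝ ∞ Du ∧
        Torus.IsLatticePeriodic Dρ ∧ Torus.IsLatticePeriodic Du ∧
        (∀ y : V3, 1 / 8 ≤ ‖y‖ → ‖y‖ ≤ 1 / 4 → Dρ y = ρ 0 y ∧ Du y = u 0 y) ∧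
        (∀ y, m ≤ Dρ y) ∧
        (∀ n : ℕ, n ≤ 4 → ∀ y, ‖iteratedFDeriv ℝ n Dρ y‖ ≤ B ∧ ‖iteratedFDeriv ℝ n Du y‖ ≤ B) := by
  obtain ⟨T₁, A₀, s₀, hT₁, hA₀0, hs₀, hdata⟩ :=
    exists_farField_data_bounds hr1 hr2 hU hS hode hSpos hlimU hlimS hUb hSb
  -- the floor `m`
  obtain ⟨m, hm⟩ : ∃ m : ℝ, m = min 1 s₀ := ⟨_, rfl⟩
  have hmpos : 0 < m := by rw [hm]; exact lt_min one_pos hs₀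
  have hm1 : m ≤ 1 := by rw [hm]; exact min_le_left _ _
  have hms₀ : m ≤ s₀ := by rw [hm]; exact min_le_right _ _
  -- the bumps
  obtain ⟨χ₁, hχ₁in, hχ₁out⟩ : ∃ χ : ContDiffBump (0 : V3), χ.rIn = 1 / 4 ∧ χ.rOut = 3 / 8 :=
    ⟨⟨1 / 4, 3 / 8, by norm_num, by norm_num⟩, rfl, rfl⟩
  obtain ⟨χ₂, hχ₂in, hχ₂out⟩ : ∃ χ : ContDiffBump (0 : V3), χ.rIn = 1 / 16 ∧ χ.rOut = 1 / 8 :=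
    ⟨⟨1 / 16, 1 / 8, by norm_num, by norm_num⟩, rfl, rfl⟩
  have hχ₁half : χ₁.rOut < 1 / 2 := by rw [hχ₁out]; norm_num
  have hχ₁half' : χ₁.rOut ≤ 1 / 2 := hχ₁half.le
  obtain ⟨B₂, hB₂0, hB₂⟩ := exists_bound_iteratedFDeriv_one_sub_bump χ₂ 4
  obtain ⟨K₀, hK₀0, hK₀⟩ := Torus.norm_iteratedFDeriv_localize_le (F := ℝ) χ₁ hχ₁half 0
  obtain ⟨K₁, hK₁0, hK₁⟩ := Torus.norm_iteratedFDeriv_localize_le (F := ℝ) χ₁ hχ₁half 1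
  obtain ⟨K₂, hK₂0, hK₂⟩ := Torus.norm_iteratedFDeriv_localize_le (F := ℝ) χ₁ hχ₁half 2
  obtain ⟨K₃, hK₃0, hK₃⟩ := Torus.norm_iteratedFDeriv_localize_le (F := ℝ) χ₁ hχ₁half 3
  obtain ⟨K₄, hK₄0, hK₄⟩ := Torus.norm_iteratedFDeriv_localize_le (F := ℝ) χ₁ hχ₁half 4
  obtain ⟨L₀, hL₀0, hL₀⟩ := Torus.norm_iteratedFDeriv_localize_le (F := V3) χ₁ hχ₁half 0
  obtain ⟨L₁, hL₁0, hL₁⟩ := Torus.norm_iteratedFDeriv_localize_le (F := V3) χ₁ hχ₁half 1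
  obtain ⟨L₂, hL₂0, hL₂⟩ := Torus.norm_iteratedFDeriv_localize_le (F := V3) χ₁ hχ₁half 2
  obtain ⟨L₃, hL₃0, hL₃⟩ := Torus.norm_iteratedFDeriv_localize_le (F := V3) χ₁ hχ₁half 3
  obtain ⟨L₄, hL₄0, hL₄⟩ := Torus.norm_iteratedFDeriv_localize_le (F := V3) χ₁ hχ₁half 4
  obtain ⟨Ksum, hKsum⟩ : ∃ K : ℝ, K = K₀ + K₁ + K₂ + K₃ + K₄ + L₀ + L₁ + L₂ + L₃ + L₄ := ⟨_, rfl⟩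
  have hKsum0 : 0 ≤ Ksum := by rw [hKsum]; positivity
  have hKle : K₀ ≤ Ksum ∧ K₁ ≤ Ksum ∧ K₂ ≤ Ksum ∧ K₃ ≤ Ksum ∧ K₄ ≤ Ksum ∧
      L₀ ≤ Ksum ∧ L₁ ≤ Ksum ∧ L₂ ≤ Ksum ∧ L₃ ≤ Ksum ∧ L₄ ≤ Ksum := by
    refine ⟨?_, ?_, ?_, ?_, ?_, ?_, ?_, ?_, ?_, ?_⟩ <;> (rw [hKsum]; linarith)
  -- the bound `A''` for the filled perturbations and the final `B`
  obtain ⟨A'', hA''⟩ : ∃ A'' : ℝ, A'' = 2 ^ 4 * B₂ * (A₀ + 1) := ⟨_, rfl⟩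
  have hA''0 : 0 ≤ A'' := by rw [hA'']; positivity
  obtain ⟨B, hB⟩ : ∃ B : ℝ, B = 1 + Ksum * A'' := ⟨_, rfl⟩
  refine ⟨T₁, B, m, hT₁, hmpos, fun T u σ ρ hT hTT₁ hu hσ hρ => ?_⟩
  obtain ⟨hu0, hρ0, hfar0, hfloor⟩ := hdata T u σ ρ hT hTT₁ hu hσ hρ
  -- the filled profiles `F`
  obtain ⟨Fρ, hFρ⟩ : ∃ F : V3 → ℝ, F = fun y => 1 + (1 - χ₂ y) • (ρ 0 y - 1) := ⟨_, rfl⟩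
  obtain ⟨Fu, hFu⟩ : ∃ F : V3 → V3, F = fun y => 0 + (1 - χ₂ y) • (u 0 y - 0) := ⟨_, rfl⟩
  have hFρs : ContDiff ℝ ∞ Fρ := by rw [hFρ]; exact contDiff_fill χ₂ (ρ 0) 1 hρ0
  have hFus : ContDiff ℝ ∞ Fu := by rw [hFu]; exact contDiff_fill χ₂ (u 0) 0 hu0
  have hFρ_eq : ∀ y : V3, 1 / 8 ≤ ‖y‖ → Fρ y = ρ 0 y := fun y hy => by
    rw [hFρ]; exact fill_eq_of_le_dist χ₂ (ρ 0) 1 (by rw [dist_zero_right, hχ₂out]; exact hy)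
  have hFu_eq : ∀ y : V3, 1 / 8 ≤ ‖y‖ → Fu y = u 0 y := fun y hy => by
    rw [hFu]; exact fill_eq_of_le_dist χ₂ (u 0) 0 (by rw [dist_zero_right, hχ₂out]; exact hy)
  have hFρ_sub : (fun y => Fρ y - 1) = fun y => (1 - χ₂ y) • (ρ 0 y - 1) := by
    funext y; rw [hFρ]; simp only; rw [add_sub_cancel_left]
  have hFu_sub : (fun y => Fu y - 0) = fun y => (1 - χ₂ y) • (u 0 y - 0) := by
    funext y; rw [hFu]; simp only [sub_zero, zero_add]
  -- bounds on all derivatives `≤ 4` of the exact data minus the constants, off the core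
  have hAρ : ∀ i, i ≤ 4 → ∀ y : V3, χ₂.rIn ≤ dist y 0 →
      ‖iteratedFDeriv ℝ i (fun y => ρ 0 y - 1) y‖ ≤ A₀ + 1 := by
    intro i hi y hy
    rw [dist_zero_right, hχ₂in] at hy
    rcases Nat.eq_zero_or_pos i with rfl | hipos
    · rw [norm_iteratedFDeriv_zero]
      have h0 := (hfar0 0 (Nat.zero_le _) y hy).2
      rw [norm_iteratedFDeriv_zero] at h0
      calc ‖ρ 0 y - 1‖ ≤ ‖ρ 0 y‖ + ‖(1 : ℝ)‖ := norm_sub_le _ _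
        _ ≤ A₀ + 1 := by rw [norm_one]; linarith
    · have hsub : iteratedFDeriv ℝ i (fun y => ρ 0 y - 1) y = iteratedFDeriv ℝ i (ρ 0) y := by
        rw [show (fun y => ρ 0 y - 1) = ρ 0 - fun _ => (1 : ℝ) from rfl,
          iteratedFDeriv_sub_apply (hρ0.contDiffAt.of_le (by exact_mod_cast le_top))
            (contDiff_const.contDiffAt), iteratedFDeriv_const_of_ne hipos.ne' (1 : ℝ)]
        simp
      rw [hsub]
      have := (hfar0 i hi y hy).2
      linarith
  have hAu : ∀ i, i ≤ 4 → ∀ y : V3, χ₂.rIn ≤ dist y 0 →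
      ‖iteratedFDeriv ℝ i (fun y => u 0 y - 0) y‖ ≤ A₀ + 1 := by
    intro i hi y hy
    rw [dist_zero_right, hχ₂in] at hy
    have hsub : (fun y => u 0 y - 0) = u 0 := by funext z; rw [sub_zero]
    rw [hsub]
    have := (hfar0 i hi y hy).1
    linarith
  have hA01 : 0 ≤ A₀ + 1 := by positivity
  have hGρ : ∀ j, j ≤ 4 → ∀ y : V3,
      ‖iteratedFDeriv ℝ j (fun y => (1 - χ₂ y) • (ρ 0 y - 1)) y‖ ≤ 2 ^ j * B₂ * (A₀ + 1) :=
    fun j hj y => norm_iteratedFDeriv_one_sub_bump_smul_le χ₂ (ρ 0) 1 hB₂0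
      (fun i hi => hB₂ i (hi.trans hj)) hρ0 hA01 (fun i hi => hAρ i (hi.trans hj)) y
  have hGu : ∀ j, j ≤ 4 → ∀ y : V3,
      ‖iteratedFDeriv ℝ j (fun y => (1 - χ₂ y) • (u 0 y - 0)) y‖ ≤ 2 ^ j * B₂ * (A₀ + 1) :=
    fun j hj y => norm_iteratedFDeriv_one_sub_bump_smul_le χ₂ (u 0) 0 hB₂0
      (fun i hi => hB₂ i (hi.trans hj)) hu0 hA01 (fun i hi => hAu i (hi.trans hj)) y
  have h2j : ∀ j, j ≤ 4 → (2 : ℝ) ^ j * B₂ * (A₀ + 1) ≤ A'' := by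
    intro j hj
    rw [hA'']
    have h2 : (2 : ℝ) ^ j ≤ 2 ^ 4 := pow_le_pow_right₀ (by norm_num) hj
    have hpos : 0 ≤ B₂ * (A₀ + 1) := by positivity
    nlinarith [mul_le_mul_of_nonneg_right h2 hpos]
  have hFρ_bd : ∀ j, j ≤ 4 → ∀ y : V3, ‖iteratedFDeriv ℝ j (fun y => Fρ y - 1) y‖ ≤ A'' := by
    intro j hj y; rw [hFρ_sub]; exact (hGρ j hj y).trans (h2j j hj)
  have hFu_bd : ∀ j, j ≤ 4 → ∀ y : V3, ‖iteratedFDeriv ℝ j (fun y => Fu y - 0) y‖ ≤ A'' := by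
    intro j hj y; rw [hFu_sub]; exact (hGu j hj y).trans (h2j j hj)
  -- the periodised fields
  obtain ⟨Pρ, hPρ⟩ : ∃ P : V3 → ℝ, P = Torus.perSum (fun y => χ₁ y • (Fρ y - 1)) := ⟨_, rfl⟩
  obtain ⟨Pu, hPu⟩ : ∃ P : V3 → V3, P = Torus.perSum (fun y => χ₁ y • (Fu y - 0)) := ⟨_, rfl⟩
  have hχ₁s : ContDiff ℝ ∞ fun y => χ₁ y := χ₁.contDiff
  have hsmρ : ContDiff ℝ ∞ Pρ := by
    rw [hPρ]
    exact Torus.contDiff_perSum (hχ₁s.smul (hFρs.sub contDiff_const))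
      (Torus.tsupport_bump_smul_subset χ₁ Fρ 1)
  have hsmu : ContDiff ℝ ∞ Pu := by
    rw [hPu]
    exact Torus.contDiff_perSum (hχ₁s.smul (hFus.sub contDiff_const))
      (Torus.tsupport_bump_smul_subset χ₁ Fu 0)
  -- bounds of the periodised perturbations
  have hPρ_bd : ∀ n, n ≤ 4 → ∀ y : V3, ‖iteratedFDeriv ℝ n Pρ y‖ ≤ Ksum * A'' := by
    intro n hn y
    have hA : ∀ j, j ≤ n → ∀ y : V3, ‖y‖ ≤ χ₁.rOut →
        ‖iteratedFDeriv ℝ j (fun y => Fρ y - 1) y‖ ≤ A'' := fun j hj y _ => hFρ_bd j (hj.trans hn) y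
    rw [hPρ]
    interval_cases n
    · exact (hK₀ hFρs 1 hA y).trans (mul_le_mul_of_nonneg_right hKle.1 hA''0)
    · exact (hK₁ hFρs 1 hA y).trans (mul_le_mul_of_nonneg_right hKle.2.1 hA''0)
    · exact (hK₂ hFρs 1 hA y).trans (mul_le_mul_of_nonneg_right hKle.2.2.1 hA''0)
    · exact (hK₃ hFρs 1 hA y).trans (mul_le_mul_of_nonneg_right hKle.2.2.2.1 hA''0)
    · exact (hK₄ hFρs 1 hA y).trans (mul_le_mul_of_nonneg_right hKle.2.2.2.2.1 hA''0)
  have hPu_bd : ∀ n, n ≤ 4 → ∀ y : V3, ‖iteratedFDeriv ℝ n Pu y‖ ≤ Ksum * A'' := by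
    intro n hn y
    have hA : ∀ j, j ≤ n → ∀ y : V3, ‖y‖ ≤ χ₁.rOut →
        ‖iteratedFDeriv ℝ j (fun y => Fu y - 0) y‖ ≤ A'' := fun j hj y _ => hFu_bd j (hj.trans hn) y
    rw [hPu]
    interval_cases n
    · exact (hL₀ hFus 0 hA y).trans (mul_le_mul_of_nonneg_right hKle.2.2.2.2.2.1 hA''0)
    · exact (hL₁ hFus 0 hA y).trans (mul_le_mul_of_nonneg_right hKle.2.2.2.2.2.2.1 hA''0)
    · exact (hL₂ hFus 0 hA y).trans (mul_le_mul_of_nonneg_right hKle.2.2.2.2.2.2.2.1 hA''0)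
    · exact (hL₃ hFus 0 hA y).trans (mul_le_mul_of_nonneg_right hKle.2.2.2.2.2.2.2.2.1 hA''0)
    · exact (hL₄ hFus 0 hA y).trans (mul_le_mul_of_nonneg_right hKle.2.2.2.2.2.2.2.2.2 hA''0)
  have hKA : 0 ≤ Ksum * A'' := mul_nonneg hKsum0 hA''0
  -- the data
  refine ⟨fun x => 1 + Pρ x, fun x => 0 + Pu x, ?_, ?_, ?_, ?_, fun y hy₁ hy₂ => ?_, fun y => ?_,
    fun n hn y => ?_⟩
  · rw [hPρ]; exact Torus.contDiff_localize (χ := χ₁) (f := Fρ) 1 hFρs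
  · rw [hPu]; exact Torus.contDiff_localize (χ := χ₁) (f := Fu) 0 hFus
  · rw [hPρ]; exact Torus.isLatticePeriodic_localize χ₁ Fρ 1
  · rw [hPu]; exact Torus.isLatticePeriodic_localize χ₁ Fu 0
  · -- agreement on the annulus
    have hy' : ‖y - Torus.latticeVec (0 : Fin 3 → ℤ)‖ ≤ χ₁.rIn := by
      rw [Torus.latticeVec_zero, sub_zero, hχ₁in]; exact hy₂
    have h1 := Torus.localize_eq_of_norm_sub_le (χ := χ₁) Fρ (1 : ℝ) hχ₁half' 0 hy'
    have h2 := Torus.localize_eq_of_norm_sub_le (χ := χ₁) Fu (0 : V3) hχ₁half' 0 hy'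
    rw [Torus.latticeVec_zero, sub_zero] at h1 h2
    simp only [hPρ, hPu]
    exact ⟨h1.trans (hFρ_eq y hy₁), h2.trans (hFu_eq y hy₁)⟩
  · -- the floor
    simp only [hPρ]
    refine le_localize_of_ball χ₁ hχ₁out hm1 (fun z hz => ?_) y
    rw [hFρ]
    simp only [smul_eq_mul]
    have h0 := χ₂.nonneg' z
    have h1 := χ₂.le_one (x := z)
    by_cases hz' : ‖z‖ ≤ 1 / 16
    · have hone : χ₂ z = 1 :=
        χ₂.one_of_mem_closedBall (by rw [mem_closedBall, dist_zero_right, hχ₂in]; exact hz')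
      rw [hone]; linarith
    · push Not at hz'
      have hE : m ≤ ρ 0 z := hms₀.trans (hfloor z hz'.le hz)
      nlinarith [mul_nonneg (sub_nonneg.2 h1) (sub_nonneg.2 hE)]
  · -- the derivative bounds
    rcases Nat.eq_zero_or_pos n with rfl | hnpos
    · rw [norm_iteratedFDeriv_zero, norm_iteratedFDeriv_zero]
      have h1 := hPρ_bd 0 (Nat.zero_le _) y
      have h2 := hPu_bd 0 (Nat.zero_le _) y
      rw [norm_iteratedFDeriv_zero] at h1 h2
      constructor
      · calc ‖1 + Pρ y‖ ≤ ‖(1 : ℝ)‖ + ‖Pρ y‖ := norm_add_le _ _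
          _ ≤ B := by rw [norm_one, hB]; linarith
      · calc ‖(0 : V3) + Pu y‖ ≤ ‖(0 : V3)‖ + ‖Pu y‖ := norm_add_le _ _
          _ ≤ B := by rw [norm_zero, hB]; linarith
    · have hne : n ≠ 0 := hnpos.ne'
      have e1 : iteratedFDeriv ℝ n (fun x => 1 + Pρ x) y = iteratedFDeriv ℝ n Pρ y := by
        rw [show (fun x => 1 + Pρ x) = (fun _ => (1 : ℝ)) + Pρ from rfl,
          iteratedFDeriv_add_apply contDiff_const.contDiffAt
            (hsmρ.contDiffAt.of_le (by exact_mod_cast le_top)),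
          iteratedFDeriv_const_of_ne hne (1 : ℝ)]
        simp
      have e2 : iteratedFDeriv ℝ n (fun x => 0 + Pu x) y = iteratedFDeriv ℝ n Pu y := by
        rw [show (fun x => (0 : V3) + Pu x) = (fun _ => (0 : V3)) + Pu from rfl,
          iteratedFDeriv_add_apply contDiff_const.contDiffAt
            (hsmu.contDiffAt.of_le (by exact_mod_cast le_top)),
          iteratedFDeriv_const_of_ne hne (0 : V3)]
        simp
      rw [e1, e2, hB]
      exact ⟨(hPρ_bd n hn y).trans (by linarith), (hPu_bd n hn y).trans (by linarith)⟩

end Data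

/-! ### Identification of the auxiliary solution with the exact one on the annuli -/

section Ident

variable {r T M : ℝ} {u : ℝ → V3 → V3} {σ ρ : ℝ → V3 → ℝ} {τ : ℝ} {ρ' : ℝ → T3 → ℝ}
  {u' : ℝ → T3 → V3}

/-- `proj (z − k) = proj z` for lattice vectors `k`. [folklore] -/
theorem proj_sub_latticeVec (z : V3) (k : Fin 3 → ℤ) :
    Torus.proj (z - Torus.latticeVec k) = Torus.proj z := by
  rw [sub_eq_add_neg, Torus.proj_add, Torus.proj_neg, Torus.proj_latticeVec, neg_zero, add_zero]

/-- **Identification on the annulus.** If a classical solution on `[0, τ) × 𝕋³` has lifted data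
equal to the exact self-similar data on the closed annulus `1/8 ≤ |y| ≤ 1/4`, and the acoustic
radius satisfies `M T^{1/r} ≤ 1/64` (cone property of `lift_eq_exact_on_cone_uniform` with
constant `M ≥ 0`), then its lift equals the exact solution on the open annulus
`9/64 < |y| < 15/64` for `0 ≤ t < τ`, `t < T` (cones of base radius `4/64` about the points of the
sphere `|x₀| = 12/64`). [cite: CaolaboraEtAl2025, Rem 1.5 p. 7] [cite: Dafermos2005, §5.2, Thm 5.2.1] -/
theorem ident_annulus (hM0 : 0 ≤ M)
    (hcone : ∀ ⦃T₂ : ℝ⦄ ⦃ρ₂ : ℝ → T3 → ℝ⦄ ⦃u₂ : ℝ → T3 → V3⦄ ⦃x₀ : V3⦄ ⦃R : ℝ⦄,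
      IsIsentropicEulerSolution (5 / 3) T₂ ρ₂ u₂ →
      (∀ y : V3, ‖y - x₀‖ < R → ρ₂ 0 (Torus.proj y) = ρ 0 y ∧ u₂ 0 (Torus.proj y) = u 0 y) →
      ∀ ⦃t : ℝ⦄, t ∈ Ico 0 T₂ → t < T → ∀ ⦃y : V3⦄,
        ‖y - x₀‖ + M * (T ^ (1 / r) - (T - t) ^ (1 / r)) < R →
        ρ₂ t (Torus.proj y) = ρ t y ∧ u₂ t (Torus.proj y) = u t y)
    (hMT : M * T ^ (1 / r) ≤ 1 / 64)
    (h₂ : IsIsentropicEulerSolution (5 / 3) τ ρ' u')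
    (hdata : ∀ y : V3, 1 / 8 ≤ ‖y‖ → ‖y‖ ≤ 1 / 4 →
      ρ' 0 (Torus.proj y) = ρ 0 y ∧ u' 0 (Torus.proj y) = u 0 y) :
    ∀ ⦃t : ℝ⦄, t ∈ Ico 0 τ → t < T → ∀ y : V3, 9 / 64 < ‖y‖ → ‖y‖ < 15 / 64 →
      ρ' t (Torus.proj y) = ρ t y ∧ u' t (Torus.proj y) = u t y := by
  intro t ht htT y hy₁ hy₂
  have hy0 : 0 < ‖y‖ := lt_trans (by norm_num) hy₁
  -- the centre on the middle sphere
  set x₀ : V3 := ((12 / 64 : ℝ) / ‖y‖) • y with hx₀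
  have hx₀n : ‖x₀‖ = 12 / 64 := by
    rw [hx₀, norm_smul, Real.norm_eq_abs, abs_of_pos (by positivity)]
    field_simp
  have hyx₀ : ‖y - x₀‖ < 3 / 64 := by
    have h1 : y - x₀ = (1 - (12 / 64 : ℝ) / ‖y‖) • y := by rw [sub_smul, one_smul, hx₀]
    have h2 : ‖y - x₀‖ = |‖y‖ - 12 / 64| := by
      rw [h1, norm_smul, Real.norm_eq_abs, ← abs_of_pos hy0, ← abs_mul, abs_of_pos hy0]
      congr 1
      field_simp
    rw [h2, abs_lt]
    constructor <;> linarith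
  -- data agree on the ball of radius `4/64` about `x₀`
  have hball : ∀ z : V3, ‖z - x₀‖ < 4 / 64 →
      ρ' 0 (Torus.proj z) = ρ 0 z ∧ u' 0 (Torus.proj z) = u 0 z := by
    intro z hz
    refine hdata z ?_ ?_
    · have h1 : ‖x₀‖ ≤ ‖z‖ + ‖z - x₀‖ := by
        have := norm_sub_le_norm_sub_add_norm_sub x₀ z 0
        -- `‖x₀‖ = ‖x₀ - 0‖ ≤ ‖x₀ - z‖ + ‖z - 0‖`
        rw [sub_zero, sub_zero, norm_sub_rev x₀ z] at this
        linarith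
      linarith
    · have h1 : ‖z‖ ≤ ‖z - x₀‖ + ‖x₀‖ := norm_le_norm_sub_add _ _
      linarith
  -- the cone condition
  have hcone' : ‖y - x₀‖ + M * (T ^ (1 / r) - (T - t) ^ (1 / r)) < 4 / 64 := by
    have h1 : M * (T ^ (1 / r) - (T - t) ^ (1 / r)) ≤ M * T ^ (1 / r) :=
      mul_le_mul_of_nonneg_left (sub_le_self _ (Real.rpow_nonneg (sub_pos.2 htT).le _)) hM0
    linarith
  exact hcone h₂ hball ht htT hcone'

end Ident

/-! ### Gluing the exact solution near the lattice points to the auxiliary solution -/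

section Glue

variable {r : ℝ} {U S : ℝ → ℝ} {Ub : V3 → V3} {Sb : V3 → ℝ}

/-- **The glued periodic solution.** Let `(ρ, u)` be the exact self-similar solution with
blow-up time `T > 0`, and `(ρ', u')` a classical solution on `[0, τ) × 𝕋³`, `T ≤ τ`, whose lift
agrees with `(ρ, u)` on the annulus `9/64 < |y| < 15/64` for `0 ≤ t < T`. Then the field equal
to `(ρ, u)(t, z − k)` on the balls `|z − k| < 14/64` (`k ∈ ℤ³`) and to the lift of `(ρ', u')`
elsewhere is a `ℤ³`-periodic classical solution on `[0, T) × ℝ³` and descends to a classical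
solution on `[0, T) × 𝕋³` (`IsIsentropicEulerSolution (5/3) T`); its lift is `(ρ, u)(t, z − k)`
for `|z − k| < 14/64` and `(ρ', u')` off these balls.
[cite: CaolaboraEtAl2025, Rem 1.5 p. 7 (finite speed of propagation ⇒ periodic setting)] -/
theorem glue_periodic (hr : 0 < r)
    (hU : ContDiff ℝ ∞ fun y : V3 => (U ‖y‖ / ‖y‖) • y) (hS : ContDiff ℝ ∞ fun y : V3 => S ‖y‖)
    (hode : ∀ ζ : ℝ, 0 < ζ →
      (r - 1) * U ζ + (ζ + U ζ) * deriv U ζ + 1 / 3 * S ζ * deriv S ζ = 0 ∧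
      (r - 1) * S ζ + (ζ + U ζ) * deriv S ζ + 1 / 3 * S ζ * (deriv U ζ + 2 * U ζ / ζ) = 0)
    (hSpos : ∀ ζ : ℝ, 0 ≤ ζ → 0 < S ζ)
    (hUb : Ub = fun y : V3 => (U ‖y‖ / ‖y‖) • y) (hSb : Sb = fun y : V3 => S ‖y‖)
    {T : ℝ} {u : ℝ → V3 → V3} {σ ρ : ℝ → V3 → ℝ}
    (hu : ∀ t x, u t x = (r⁻¹ * (T - t) ^ (1 / r - 1)) • Ub ((T - t) ^ (-1 / r) • x))
    (hσ : ∀ t x, σ t x = (r⁻¹ * (T - t) ^ (1 / r - 1)) * Sb ((T - t) ^ (-1 / r) • x))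
    (hρ : ∀ t x, ρ t x = (σ t x / 3) ^ 3)
    {τ : ℝ} (hTτ : T ≤ τ) {ρ' : ℝ → T3 → ℝ} {u' : ℝ → T3 → V3}
    (h₂ : IsIsentropicEulerSolution (5 / 3) τ ρ' u')
    (hid : ∀ t ∈ Ico 0 T, ∀ y : V3, 9 / 64 < ‖y‖ → ‖y‖ < 15 / 64 →
      ρ' t (Torus.proj y) = ρ t y ∧ u' t (Torus.proj y) = u t y) :
    ∃ (ρg : ℝ → T3 → ℝ) (ug : ℝ → T3 → V3), IsIsentropicEulerSolution (5 / 3) T ρg ug ∧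
      (∀ t (z : V3), (∃ k : Fin 3 → ℤ, ‖z - Torus.latticeVec k‖ < 14 / 64) →
        ρg t (Torus.proj z) = ρ t (z - Torus.latticeVec fun i => round (z i)) ∧
        ug t (Torus.proj z) = u t (z - Torus.latticeVec fun i => round (z i))) ∧
      (∀ t (z : V3), (∀ k : Fin 3 → ℤ, 14 / 64 ≤ ‖z - Torus.latticeVec k‖) →
        ρg t (Torus.proj z) = ρ' t (Torus.proj z) ∧ ug t (Torus.proj z) = u' t (Torus.proj z)) := by
  classical
  -- the exact solution
  obtain ⟨hρs, hus, hpos, hmassE, hmomE, -, -⟩ :=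
    exactSolution_of_profile (T := T) hr hU hS hode hSpos hUb hSb hu hσ hρ
  -- the two open sets
  set A : Set V3 := {z | ∃ k : Fin 3 → ℤ, ‖z - Torus.latticeVec k‖ < 14 / 64} with hA
  set Λ : Set V3 := Set.range (Torus.latticeVec : (Fin 3 → ℤ) → V3) with hΛ
  set B : Set V3 := {z | 10 / 64 < infDist z Λ} with hB
  have hΛne : Λ.Nonempty := ⟨_, ⟨0, rfl⟩⟩
  have hAopen : IsOpen A := by
    have hA' : A = ⋃ k : Fin 3 → ℤ, ball (Torus.latticeVec k) (14 / 64) := by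
      ext z
      simp only [hA, mem_setOf_eq, mem_iUnion, mem_ball, dist_eq_norm]
    rw [hA']
    exact isOpen_iUnion fun _ => isOpen_ball
  have hBopen : IsOpen B := isOpen_lt continuous_const (continuous_infDist_pt (s := Λ))
  have hAB : ∀ z, z ∈ A ∨ z ∈ B := by
    intro z
    by_cases hz : z ∈ A
    · exact Or.inl hz
    · right
      have hz' : ∀ k : Fin 3 → ℤ, 14 / 64 ≤ ‖z - Torus.latticeVec k‖ := by
        intro k
        by_contra hlt
        exact hz ⟨k, not_le.1 hlt⟩
      have h1 : (14 / 64 : ℝ) ≤ infDist z Λ := by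
        refine (le_infDist hΛne).2 ?_
        rintro _ ⟨k, rfl⟩
        rw [dist_eq_norm]
        exact hz' k
      show 10 / 64 < infDist z Λ
      linarith
  have hBfar : ∀ z ∈ B, ∀ k : Fin 3 → ℤ, 10 / 64 < ‖z - Torus.latticeVec k‖ := by
    intro z hz k
    have h1 : infDist z Λ ≤ dist z (Torus.latticeVec k) := infDist_le_dist_of_mem ⟨k, rfl⟩
    rw [dist_eq_norm] at h1
    exact lt_of_lt_of_le hz h1
  -- the pieces
  set P₁ : ℝ → V3 → ℝ := fun t z => ρ t (z - Torus.latticeVec fun i => round (z i)) with hP₁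
  set W₁ : ℝ → V3 → V3 := fun t z => u t (z - Torus.latticeVec fun i => round (z i)) with hW₁
  set P₂ : ℝ → V3 → ℝ := fun t z => ρ' t (Torus.proj z) with hP₂
  set W₂ : ℝ → V3 → V3 := fun t z => u' t (Torus.proj z) with hW₂
  set P : ℝ → V3 → ℝ := fun t z => if z ∈ A then P₁ t z else P₂ t z with hP
  set W : ℝ → V3 → V3 := fun t z => if z ∈ A then W₁ t z else W₂ t z with hW
  have hST : Ico 0 T ×ˢ ball (0 : V3) (14 / 64) ⊆ {p : ℝ × V3 | p.1 < T} := fun p hp => hp.1.2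
  have hP₁s : ContDiffOn ℝ ∞ (fun p : ℝ × V3 => P₁ p.1 p.2) (Ico 0 T ×ˢ A) :=
    Torus.contDiffOn_recenter_param (by norm_num) (hρs.mono hST)
  have hW₁s : ContDiffOn ℝ ∞ (fun p : ℝ × V3 => W₁ p.1 p.2) (Ico 0 T ×ˢ A) :=
    Torus.contDiffOn_recenter_param (by norm_num) (hus.mono hST)
  have hsubτ : Ico 0 T ×ˢ B ⊆ Ico 0 τ ×ˢ (univ : Set V3) :=
    prod_mono (Ico_subset_Ico_right hTτ) (subset_univ _)
  have hP₂s : ContDiffOn ℝ ∞ (fun p : ℝ × V3 => P₂ p.1 p.2) (Ico 0 T ×ˢ B) :=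
    h₂.lift_smooth.1.mono hsubτ
  have hW₂s : ContDiffOn ℝ ∞ (fun p : ℝ × V3 => W₂ p.1 p.2) (Ico 0 T ×ˢ B) :=
    h₂.lift_smooth.2.mono hsubτ
  -- agreement on `A ∩ B`
  have hround : ∀ {z : V3} {k : Fin 3 → ℤ}, ‖z - Torus.latticeVec k‖ < 14 / 64 →
      (Torus.latticeVec fun i => round (z i)) = Torus.latticeVec k :=
    fun hz => Torus.latticeVec_round_eq (hz.trans (by norm_num))
  have hag : ∀ t ∈ Ico 0 T, ∀ z, z ∈ A → z ∈ B → P₁ t z = P₂ t z ∧ W₁ t z = W₂ t z := by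
    intro t ht z hzA hzB
    obtain ⟨k, hk⟩ := hzA
    have hk' := hBfar z hzB k
    have h := hid t ht (z - Torus.latticeVec k) (by linarith) (by linarith)
    rw [proj_sub_latticeVec] at h
    simp only [hP₁, hW₁, hP₂, hW₂, hround hk]
    exact ⟨h.1.symm, h.2.symm⟩
  -- the equations for the recentred exact solution on `A`
  have heqA : ∀ t ∈ Ico 0 T, ∀ z ∈ A,
      (derivWithin (fun s => P₁ s z) (Ico 0 T) t +
        ∑ i, fderiv ℝ (fun w => P₁ t w * W₁ t w i) z (EuclideanSpace.single i 1) = 0) ∧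
      (P₁ t z • derivWithin (fun s => W₁ s z) (Ico 0 T) t +
          P₁ t z • ∑ i, W₁ t z i • fderiv ℝ (W₁ t) z (EuclideanSpace.single i 1) +
        gradient (fun w => P₁ t w ^ (5 / 3 : ℝ) / (5 / 3)) z = 0) := by
    intro t ht z hzA
    obtain ⟨k, hk⟩ := hzA
    have htT : t < T := ht.2
    -- the translated exact solution `(Pk, Wk)` solves the system at `(t, z)`
    set Pk : ℝ → V3 → ℝ := fun s w => ρ s (w - Torus.latticeVec k) with hPk
    set Wk : ℝ → V3 → V3 := fun s w => u s (w - Torus.latticeVec k) with hWk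
    have hm := hmassE t htT (z - Torus.latticeVec k)
    have hmo := hmomE t htT (z - Torus.latticeVec k)
    have e1 : ∀ i, fderiv ℝ (fun w => Pk t w * Wk t w i) z =
        fderiv ℝ (fun w => ρ t w * u t w i) (z - Torus.latticeVec k) := by
      intro i
      have h := fderiv_comp_sub (𝕜 := ℝ) (f := fun w => ρ t w * u t w i) (x := z)
        (Torus.latticeVec k)
      simpa only [hPk, hWk] using h
    have e2 : fderiv ℝ (Wk t) z = fderiv ℝ (u t) (z - Torus.latticeVec k) := by
      have h := fderiv_comp_sub (𝕜 := ℝ) (f := u t) (x := z) (Torus.latticeVec k)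
      simpa only [hWk] using h
    have e3 : gradient (fun w => Pk t w ^ (5 / 3 : ℝ) / (5 / 3)) z =
        gradient (fun w => ρ t w ^ (5 / 3 : ℝ) / (5 / 3)) (z - Torus.latticeVec k) := by
      unfold gradient
      have h := fderiv_comp_sub (𝕜 := ℝ) (f := fun w => ρ t w ^ (5 / 3 : ℝ) / (5 / 3)) (x := z)
        (Torus.latticeVec k)
      simp only [hPk] at h ⊢
      rw [h]
    have hdP : derivWithin (fun s => Pk s z) (Ico 0 T) t =
        deriv (fun s => ρ s (z - Torus.latticeVec k)) t :=
      IsentropicEuler.derivWithin_Ico_eq_deriv_of_hasDerivAt ht (hasDerivAt_time_slice hρs htT _)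
    have hdW : derivWithin (fun s => Wk s z) (Ico 0 T) t =
        deriv (fun s => u s (z - Torus.latticeVec k)) t :=
      IsentropicEuler.derivWithin_Ico_eq_deriv_of_hasDerivAt ht (hasDerivAt_time_slice hus htT _)
    have hmassk : derivWithin (fun s => Pk s z) (Ico 0 T) t +
        ∑ i, fderiv ℝ (fun w => Pk t w * Wk t w i) z (EuclideanSpace.single i 1) = 0 := by
      rw [hdP, Finset.sum_congr rfl fun i _ => by rw [e1 i]]
      exact hm
    have hmomk : Pk t z • derivWithin (fun s => Wk s z) (Ico 0 T) t +
        Pk t z • ∑ i, Wk t z i • fderiv ℝ (Wk t) z (EuclideanSpace.single i 1) +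
        gradient (fun w => Pk t w ^ (5 / 3 : ℝ) / (5 / 3)) z = 0 := by
      rw [hdW, e2, e3]
      exact hmo
    -- `(P₁, W₁)` agrees with `(Pk, Wk)` at `z` for all times and near `z` at time `t`
    have hball : ball (Torus.latticeVec k) (1 / 2) ∈ 𝓝 z := isOpen_ball.mem_nhds (by
      rw [mem_ball, dist_eq_norm]; exact hk.trans (by norm_num))
    have hrw : ∀ w ∈ ball (Torus.latticeVec k) (1 / 2),
        (Torus.latticeVec fun i => round (w i)) = Torus.latticeVec k := by
      intro w hw
      rw [mem_ball, dist_eq_norm] at hw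
      exact Torus.latticeVec_round_eq hw
    refine IsentropicEuler.equations_congr (P' := Pk) (W' := Wk) (fun s => ?_) (fun s => ?_) ?_ ?_
      hmassk hmomk
    · simp only [hP₁, hPk, hround hk]
    · simp only [hW₁, hWk, hround hk]
    · filter_upwards [hball] with w hw
      simp only [hP₁, hPk, hrw w hw]
    · filter_upwards [hball] with w hw
      simp only [hW₁, hWk, hrw w hw]
  -- the equations for the lift of the auxiliary solution (everywhere)
  have heqB : ∀ t ∈ Ico 0 T, ∀ z : V3,
      (derivWithin (fun s => P₂ s z) (Ico 0 T) t +
        ∑ i, fderiv ℝ (fun w => P₂ t w * W₂ t w i) z (EuclideanSpace.single i 1) = 0) ∧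
      (P₂ t z • derivWithin (fun s => W₂ s z) (Ico 0 T) t +
          P₂ t z • ∑ i, W₂ t z i • fderiv ℝ (W₂ t) z (EuclideanSpace.single i 1) +
        gradient (fun w => P₂ t w ^ (5 / 3 : ℝ) / (5 / 3)) z = 0) := by
    intro t ht z
    have htτ : t ∈ Ico 0 τ := ⟨ht.1, ht.2.trans_le hTτ⟩
    have h := h₂.lift_equations htτ z
    have hsub : Ico 0 T ⊆ Ico 0 τ := Ico_subset_Ico_right hTτ
    have hd1 : derivWithin (fun s => P₂ s z) (Ico 0 T) t =
        derivWithin (fun s => ρ' s (Torus.proj z)) (Ico 0 τ) t :=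
      derivWithin_subset hsub (uniqueDiffOn_Ico 0 T t ht)
        (differentiableWithinAt_time_slice h₂.lift_smooth.1 htτ z)
    have hd2 : derivWithin (fun s => W₂ s z) (Ico 0 T) t =
        derivWithin (fun s => u' s (Torus.proj z)) (Ico 0 τ) t :=
      derivWithin_subset hsub (uniqueDiffOn_Ico 0 T t ht)
        (differentiableWithinAt_time_slice h₂.lift_smooth.2 htτ z)
    simp only [hP₂, hW₂] at hd1 hd2 ⊢
    rw [hd1, hd2]
    exact h
  -- glue in space
  obtain ⟨hPs, hWs, hmass, hmom⟩ := IsentropicEuler.glue_space (S := Ico 0 T) (γ := (5 / 3 : ℝ))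
    (P := P) (W := W) hAopen hBopen hAB hP₁s hW₁s hP₂s hW₂s
    (fun t z hz => by simp only [hP]; rw [if_pos hz])
    (fun t z hz => by simp only [hW]; rw [if_pos hz])
    (fun t z hz => by simp only [hP]; rw [if_neg hz])
    (fun t z hz => by simp only [hW]; rw [if_neg hz])
    (fun t ht z hzA hzB => (hag t ht z hzA hzB).1) (fun t ht z hzA hzB => (hag t ht z hzA hzB).2)
    (fun t ht z hz => (heqA t ht z hz).1) (fun t ht z hz => (heqA t ht z hz).2)
    (fun t ht z _ => (heqB t ht z).1) (fun t ht z _ => (heqB t ht z).2)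
  -- positivity and periodicity
  have hPpos : ∀ t ∈ Ico 0 T, ∀ z, 0 < P t z := by
    intro t ht z
    simp only [hP]
    split_ifs with hz
    · exact hpos t ht.2 _
    · exact h₂.density_pos t ⟨ht.1, ht.2.trans_le hTτ⟩ _
  have hmemA : ∀ (z : V3) (j : Fin 3), z + EuclideanSpace.single j (1 : ℝ) ∈ A ↔ z ∈ A := by
    intro z j
    rw [← Torus.latticeVec_single j]
    constructor
    · rintro ⟨k, hk⟩
      refine ⟨k + -Pi.single j 1, ?_⟩
      rw [Torus.latticeVec_add, Torus.latticeVec_neg, ← sub_sub, sub_neg_eq_add]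
      rwa [add_sub_right_comm] at hk
    · rintro ⟨k, hk⟩
      refine ⟨k + Pi.single j 1, ?_⟩
      rwa [Torus.latticeVec_add, add_sub_add_right_eq_sub]
  have hPper : ∀ t, Torus.IsLatticePeriodic (P t) := by
    intro t j z
    simp only [hP]
    by_cases hz : z ∈ A
    · rw [if_pos hz, if_pos ((hmemA z j).2 hz)]
      exact Torus.isLatticePeriodic_recenter (ρ t) j z
    · rw [if_neg hz, if_neg (fun h => hz ((hmemA z j).1 h))]
      exact Torus.isLatticePeriodic_lift (ρ' t) j z
  have hWper : ∀ t, Torus.IsLatticePeriodic (W t) := by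
    intro t j z
    simp only [hW]
    by_cases hz : z ∈ A
    · rw [if_pos hz, if_pos ((hmemA z j).2 hz)]
      exact Torus.isLatticePeriodic_recenter (u t) j z
    · rw [if_neg hz, if_neg (fun h => hz ((hmemA z j).1 h))]
      exact Torus.isLatticePeriodic_lift (u' t) j z
  -- descend
  refine ⟨fun t => Torus.descend (P t) (hPper t), fun t => Torus.descend (W t) (hWper t),
    IsentropicEuler.isIsentropicEulerSolution_descend hPper hWper hPs hWs hPpos hmass hmom,
    fun t z hz => ?_, fun t z hz => ?_⟩
  · dsimp only
    rw [IsentropicEuler.descend_proj, IsentropicEuler.descend_proj]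
    have hzA : z ∈ A := hz
    simp only [hP, hW, if_pos hzA]
    exact ⟨rfl, rfl⟩
  · dsimp only
    rw [IsentropicEuler.descend_proj, IsentropicEuler.descend_proj]
    have hzA : z ∉ A := fun ⟨k, hk⟩ => not_lt.2 (hz k) hk
    simp only [hP, hW, if_neg hzA]
    exact ⟨rfl, rfl⟩

end Glue

/-! ### The rate clauses for the glued solution -/

section Rates

variable {r : ℝ} {U S : ℝ → ℝ} {Ub : V3 → V3} {Sb : V3 → ℝ}

/-- Uniformisation of the all-orders bounds of the exact solution over orders `≤ n` on the unit
ball, for blow-up times `T ≤ 1`: one constant and one NONNEGATIVE exponent serve all orders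
`i ≤ n`. [folklore] -/
theorem exists_uniform_exact_bounds {T : ℝ} (hT1 : T ≤ 1) {u : ℝ → V3 → V3} {σ : ℝ → V3 → ℝ}
    (h : ∀ n : ℕ, ∃ (k : ℕ) (C p : ℝ), ∀ t ∈ Ico 0 T, ∀ x : V3,
      ‖iteratedFDeriv ℝ n (u t) x‖ ≤ C * (T - t) ^ (-p) * (1 + ‖x‖) ^ k ∧
        ‖iteratedFDeriv ℝ n (σ t) x‖ ≤ C * (T - t) ^ (-p) * (1 + ‖x‖) ^ k) (n : ℕ) :
    ∃ C p : ℝ, 0 ≤ C ∧ 0 ≤ p ∧ ∀ i, i ≤ n → ∀ t ∈ Ico 0 T, ∀ x : V3, ‖x‖ ≤ 1 →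
      ‖iteratedFDeriv ℝ i (u t) x‖ ≤ C * (T - t) ^ (-p) ∧
        ‖iteratedFDeriv ℝ i (σ t) x‖ ≤ C * (T - t) ^ (-p) := by
  -- one order, weakened to any larger constant / exponent
  have hone : ∀ i : ℕ, ∃ C p : ℝ, 0 ≤ C ∧ 0 ≤ p ∧ ∀ C' p' : ℝ, C ≤ C' → p ≤ p' →
      ∀ t ∈ Ico 0 T, ∀ x : V3, ‖x‖ ≤ 1 →
      ‖iteratedFDeriv ℝ i (u t) x‖ ≤ C' * (T - t) ^ (-p') ∧
        ‖iteratedFDeriv ℝ i (σ t) x‖ ≤ C' * (T - t) ^ (-p') := by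
    intro i
    obtain ⟨k, C, p, hb⟩ := h i
    refine ⟨max C 0 * 2 ^ k, max p 0, by positivity, le_max_right _ _,
      fun C' p' hC' hp' t ht x hx => ?_⟩
    have hl0 : 0 < T - t := sub_pos.2 ht.2
    have hl1 : T - t ≤ 1 := by linarith [ht.1]
    have h1 : (1 + ‖x‖) ^ k ≤ 2 ^ k := pow_le_pow_left₀ (by positivity) (by linarith) k
    have h2 : (T - t) ^ (-p) ≤ (T - t) ^ (-p') :=
      Real.rpow_le_rpow_of_exponent_ge hl0 hl1 (by linarith [le_max_left p 0])
    have hC0 : 0 ≤ max C 0 * 2 ^ k := by positivity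
    have key : C * (T - t) ^ (-p) * (1 + ‖x‖) ^ k ≤ C' * (T - t) ^ (-p') := by
      calc C * (T - t) ^ (-p) * (1 + ‖x‖) ^ k ≤ max C 0 * (T - t) ^ (-p) * (1 + ‖x‖) ^ k := by
            gcongr; exact le_max_left _ _
        _ ≤ max C 0 * (T - t) ^ (-p') * 2 ^ k := by
            have hm0 : 0 ≤ max C 0 := le_max_right _ _
            exact mul_le_mul (mul_le_mul_of_nonneg_left h2 hm0) h1 (by positivity)
              (mul_nonneg hm0 (Real.rpow_nonneg hl0.le _))
        _ = (max C 0 * 2 ^ k) * (T - t) ^ (-p') := by ring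
        _ ≤ C' * (T - t) ^ (-p') := mul_le_mul_of_nonneg_right hC' (Real.rpow_nonneg hl0.le _)
    exact ⟨(hb t ht x).1.trans key, (hb t ht x).2.trans key⟩
  induction n with
  | zero =>
    obtain ⟨C, p, hC, hp, hb⟩ := hone 0
    exact ⟨C, p, hC, hp, fun i hi => by
      obtain rfl : i = 0 := Nat.le_zero.1 hi; exact hb C p le_rfl le_rfl⟩
  | succ n ih =>
    obtain ⟨C, p, hC, hp, hb⟩ := ih
    obtain ⟨C', p', hC', hp', hb'⟩ := hone (n + 1)
    refine ⟨max C C', max p p', le_max_of_le_left hC, le_max_of_le_left hp, fun i hi t ht x hx => ?_⟩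
    have hl0 : 0 < T - t := sub_pos.2 ht.2
    have hl1 : T - t ≤ 1 := by linarith [ht.1]
    rcases Nat.lt_or_eq_of_le hi with hlt | rfl
    · have h1 := hb i (Nat.lt_succ_iff.1 hlt) t ht x hx
      have hmono : C * (T - t) ^ (-p) ≤ max C C' * (T - t) ^ (-max p p') := by
        calc C * (T - t) ^ (-p) ≤ max C C' * (T - t) ^ (-p) :=
              mul_le_mul_of_nonneg_right (le_max_left _ _) (Real.rpow_nonneg hl0.le _)
          _ ≤ max C C' * (T - t) ^ (-max p p') :=
              mul_le_mul_of_nonneg_left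
                (Real.rpow_le_rpow_of_exponent_ge hl0 hl1 (by linarith [le_max_left p p']))
                (le_max_of_le_left hC)
      exact ⟨h1.1.trans hmono, h1.2.trans hmono⟩
    · exact hb' (max C C') (max p p') (le_max_right _ _) (le_max_right _ _) t ht x hx

/-- **The rate clauses for the glued solution.** In the setting of `glue_periodic`
(`0 < T ≤ 1`, `T < τ`), the descended solution satisfies the four rate clauses of
`CaolaboraEtAl2025_thm12_rates` with blow-up time `T` and self-similar exponent `r`: Type I for the
first derivatives, polynomial bounds on ALL derivatives of the lifts, a positive density floor
(`p_l = 0`), and the exact core law `ρ(t, 0) = (S̄(0)/(3r))³ (T−t)^{−3(1−1/r)}`.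
[cite: CaolaboraEtAl2025, Thm 1.2 p. 6, Rem 1.5 p. 7; Lemmas 3.5–3.7 pp. 25–27 (the printed
counterparts of the four clauses)] -/
theorem rates_of_glue (hr1 : 1 < r) (hr2 : r < 2)
    (hU : ContDiff ℝ ∞ fun y : V3 => (U ‖y‖ / ‖y‖) • y) (hS : ContDiff ℝ ∞ fun y : V3 => S ‖y‖)
    (hode : ∀ ζ : ℝ, 0 < ζ →
      (r - 1) * U ζ + (ζ + U ζ) * deriv U ζ + 1 / 3 * S ζ * deriv S ζ = 0 ∧
      (r - 1) * S ζ + (ζ + U ζ) * deriv S ζ + 1 / 3 * S ζ * (deriv U ζ + 2 * U ζ / ζ) = 0)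
    (hSpos : ∀ ζ : ℝ, 0 ≤ ζ → 0 < S ζ)
    (hlimU : Tendsto (fun ζ => U ζ / ζ) atTop (𝓝 0))
    (hlimS : Tendsto (fun ζ => S ζ / ζ) atTop (𝓝 0))
    (hUb : Ub = fun y : V3 => (U ‖y‖ / ‖y‖) • y) (hSb : Sb = fun y : V3 => S ‖y‖)
    {T : ℝ} (hT : 0 < T) (hT1 : T ≤ 1) {u : ℝ → V3 → V3} {σ ρ : ℝ → V3 → ℝ}
    (hu : ∀ t x, u t x = (r⁻¹ * (T - t) ^ (1 / r - 1)) • Ub ((T - t) ^ (-1 / r) • x))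
    (hσ : ∀ t x, σ t x = (r⁻¹ * (T - t) ^ (1 / r - 1)) * Sb ((T - t) ^ (-1 / r) • x))
    (hρ : ∀ t x, ρ t x = (σ t x / 3) ^ 3)
    {τ : ℝ} (hTτ : T < τ) {ρ' : ℝ → T3 → ℝ} {u' : ℝ → T3 → V3}
    (h₂ : IsIsentropicEulerSolution (5 / 3) τ ρ' u')
    (hid : ∀ t ∈ Ico 0 T, ∀ y : V3, 9 / 64 < ‖y‖ → ‖y‖ < 15 / 64 →
      ρ' t (Torus.proj y) = ρ t y ∧ u' t (Torus.proj y) = u t y) :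
    ∃ (ρg : ℝ → T3 → ℝ) (ug : ℝ → T3 → V3), IsIsentropicEulerSolution (5 / 3) T ρg ug ∧
      (∃ C : ℝ, ∀ t ∈ Ico 0 T, ∀ x, ∀ i : Fin 3,
        ‖Torus.partialDeriv i (ug t) x‖ ≤ C / (T - t) ∧
        |Torus.partialDeriv i (fun y => ρg t y ^ (1 / 3 : ℝ)) x| ≤ C / (T - t)) ∧
      (∀ n : ℕ, n ≤ 6 → ∃ Cn pn : ℝ, ∀ t ∈ Ico 0 T, ∀ y : V3,
        ‖iteratedFDeriv ℝ n (Torus.lift (ρg t)) y‖ ≤ Cn * (T - t) ^ (-pn) ∧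
        ‖iteratedFDeriv ℝ n (Torus.lift (ug t)) y‖ ≤ Cn * (T - t) ^ (-pn)) ∧
      (∃ cl pl : ℝ, 0 < cl ∧ ∀ t ∈ Ico 0 T, ∀ x, cl * (T - t) ^ pl ≤ ρg t x) ∧
      (∃ c : ℝ, 0 < c ∧ ∀ t ∈ Ico 0 T, ∃ x, c * (T - t) ^ (-(3 * (1 - 1 / r))) ≤ ρg t x) := by
  have hr0 : 0 < r := by linarith
  have hUb' : ContDiff ℝ ∞ Ub := hUb ▸ hU
  have hSb' : ContDiff ℝ ∞ Sb := hSb ▸ hS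
  obtain ⟨ρg, ug, hsol, hinA, hout⟩ :=
    glue_periodic hr0 hU hS hode hSpos hUb hSb hu hσ hρ hTτ.le h₂ hid
  obtain ⟨hρs, hus, hpos, -, -, hcore, -⟩ :=
    exactSolution_of_profile (T := T) hr0 hU hS hode hSpos hUb hSb hu hσ hρ
  -- compact time set for the auxiliary solution
  have hK : IsCompact (Icc (0 : ℝ) T) := isCompact_Icc
  have hKS : Icc (0 : ℝ) T ⊆ Ico 0 τ := fun t ht => ⟨ht.1, ht.2.trans_lt hTτ⟩
  have hIco : ∀ {t : ℝ}, t ∈ Ico 0 T → t ∈ Icc 0 T := fun ht => ⟨ht.1, ht.2.le⟩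
  have hIcoτ : ∀ {t : ℝ}, t ∈ Ico 0 T → t ∈ Ico 0 τ := fun ht => ⟨ht.1, ht.2.trans hTτ⟩
  have hSτ : UniqueDiffOn ℝ (Ico 0 τ) := uniqueDiffOn_Ico 0 τ
  -- local description of the glued solution, upstairs
  have hround : ∀ {z : V3} {k : Fin 3 → ℤ}, ‖z - Torus.latticeVec k‖ < 14 / 64 →
      (Torus.latticeVec fun i => round (z i)) = Torus.latticeVec k :=
    fun hz => Torus.latticeVec_round_eq (hz.trans (by norm_num))
  have hnearA : ∀ (t : ℝ) (z : V3) (k : Fin 3 → ℤ), ‖z - Torus.latticeVec k‖ < 14 / 64 →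
      ∀ᶠ w in 𝓝 z, ρg t (Torus.proj w) = ρ t (w - Torus.latticeVec k) ∧
        ug t (Torus.proj w) = u t (w - Torus.latticeVec k) := by
    intro t z k hk
    have hball : ball (Torus.latticeVec k) (14 / 64) ∈ 𝓝 z :=
      isOpen_ball.mem_nhds (by rwa [mem_ball, dist_eq_norm])
    filter_upwards [hball] with w hw
    rw [mem_ball, dist_eq_norm] at hw
    have h := hinA t w ⟨k, hw⟩
    rwa [hround hw] at h
  have hnearB : ∀ t ∈ Ico 0 T, ∀ z : V3, (∀ k : Fin 3 → ℤ, 14 / 64 ≤ ‖z - Torus.latticeVec k‖) →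
      ∀ᶠ w in 𝓝 z, ρg t (Torus.proj w) = ρ' t (Torus.proj w) ∧
        ug t (Torus.proj w) = u' t (Torus.proj w) := by
    intro t ht z hz
    filter_upwards [isOpen_ball.mem_nhds (mem_ball_self (by norm_num : (0 : ℝ) < 4 / 64))] with w hw
    rw [mem_ball, dist_eq_norm] at hw
    have hw10 : ∀ k : Fin 3 → ℤ, 10 / 64 < ‖w - Torus.latticeVec k‖ := by
      intro k
      have h1 := norm_sub_le_norm_sub_add_norm_sub z w (Torus.latticeVec k)
      rw [norm_sub_rev z w] at h1
      linarith [hz k]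
    by_cases hwA : ∃ k : Fin 3 → ℤ, ‖w - Torus.latticeVec k‖ < 14 / 64
    · obtain ⟨k, hk⟩ := hwA
      have h1 := hinA t w ⟨k, hk⟩
      rw [hround hk] at h1
      have h2 := hid t ht (w - Torus.latticeVec k) (by linarith [hw10 k]) (by linarith)
      rw [proj_sub_latticeVec] at h2
      exact ⟨h1.1.trans h2.1.symm, h1.2.trans h2.2.symm⟩
    · push Not at hwA
      exact hout t w hwA
  refine ⟨ρg, ug, hsol, ?_, ?_, ?_, ?_⟩
  · ---------------------------------------------------------------- Type I
    obtain ⟨CE, hCE⟩ := typeI_of_profile (T := T) hr0 hU hS hode hSpos hlimU hlimS hUb hSb hu hσ hρ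
    -- bounds for the auxiliary solution on `[0, T] × 𝕋³`
    have hsm1 : Torus.IsSmoothSpaceTimeOn (Ico 0 τ) u' := h₂.smooth_velocity
    have hsm2 : Torus.IsSmoothSpaceTimeOn (Ico 0 τ) (fun t y => ρ' t y ^ (1 / 3 : ℝ)) := by
      have hd : ContDiffOn ℝ ∞ (Torus.stLift ρ') (Ico 0 τ ×ˢ univ) := h₂.smooth_density
      change ContDiffOn ℝ ∞ (fun q => (Torus.stLift ρ' q) ^ (1 / 3 : ℝ)) (Ico 0 τ ×ˢ univ)
      exact hd.rpow_const_of_ne fun q hq => (h₂.density_pos q.1 hq.1 _).ne'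
    have hCu : ∀ i : Fin 3, ∃ C : ℝ, ∀ t ∈ Icc 0 T, ∀ x, ‖Torus.partialDeriv i (u' t) x‖ ≤ C :=
      fun i => (hsm1.partialDeriv hSτ i).exists_norm_le_of_isCompact hK hKS
    have hCs : ∀ i : Fin 3, ∃ C : ℝ, ∀ t ∈ Icc 0 T, ∀ x,
        ‖Torus.partialDeriv i (fun y => ρ' t y ^ (1 / 3 : ℝ)) x‖ ≤ C :=
      fun i => (hsm2.partialDeriv hSτ i).exists_norm_le_of_isCompact hK hKS
    choose Cu hCu using hCu
    choose Cs hCs using hCs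
    obtain ⟨Caux, hCaux⟩ : ∃ C : ℝ, C = ∑ i, (|Cu i| + |Cs i|) := ⟨_, rfl⟩
    have hCaux0 : 0 ≤ Caux := by rw [hCaux]; positivity
    have hCauxi : ∀ i, |Cu i| ≤ Caux ∧ |Cs i| ≤ Caux := by
      intro i
      have h := Finset.single_le_sum (f := fun j : Fin 3 => |Cu j| + |Cs j|)
        (fun j _ => by positivity) (Finset.mem_univ i)
      rw [← hCaux] at h
      exact ⟨le_trans (le_add_of_nonneg_right (abs_nonneg _)) h,
        le_trans (le_add_of_nonneg_left (abs_nonneg _)) h⟩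
    refine ⟨|CE| + Caux * T, fun t ht x i => ?_⟩
    have hl0 : 0 < T - t := sub_pos.2 ht.2
    -- the two kinds of bounds both imply the claimed one
    have hE : CE / (T - t) ≤ (|CE| + Caux * T) / (T - t) :=
      div_le_div_of_nonneg_right (by linarith [le_abs_self CE, mul_nonneg hCaux0 hT.le]) hl0.le
    have haux : Caux ≤ (|CE| + Caux * T) / (T - t) := by
      rw [le_div_iff₀ hl0]
      nlinarith [abs_nonneg CE, ht.1, mul_nonneg hCaux0 ht.1]
    obtain ⟨z, rfl⟩ := Torus.proj_surjective x
    have hρg1 : Torus.IsContDiff 1 (fun y => ρg t y ^ (1 / 3 : ℝ)) := by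
      have h1 : Torus.IsSmooth (ρg t) := hsol.smooth_density.isSmooth_slice ht
      have h2 : ContDiff ℝ ∞ fun w => (Torus.lift (ρg t) w) ^ (1 / 3 : ℝ) :=
        h1.rpow_const_of_ne fun w => (hsol.density_pos t ht _).ne'
      exact (h2.of_le (by exact_mod_cast le_top) : ContDiff ℝ 1 _)
    have hug1 : Torus.IsContDiff 1 (ug t) := (hsol.smooth_velocity.isSmooth_slice ht).isContDiff (by simp)
    by_cases hzA : ∃ k : Fin 3 → ℤ, ‖z - Torus.latticeVec k‖ < 14 / 64
    · -- exact region
      obtain ⟨k, hk⟩ := hzA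
      have hev := hnearA t z k hk
      have hb := hCE t ht.2 (z - Torus.latticeVec k) i
      constructor
      · rw [IsentropicEuler.partialDeriv_proj_eq hug1]
        have hev' : Torus.lift (ug t) =ᶠ[𝓝 z] fun w => u t (w - Torus.latticeVec k) :=
          hev.mono fun w hw => by rw [Torus.lift_apply]; exact hw.2
        rw [hev'.fderiv_eq, fderiv_comp_sub]
        exact hb.1.trans hE
      · rw [IsentropicEuler.partialDeriv_proj_eq hρg1]
        have hev' : Torus.lift (fun y => ρg t y ^ (1 / 3 : ℝ)) =ᶠ[𝓝 z]
            fun w => ρ t (w - Torus.latticeVec k) ^ (1 / 3 : ℝ) :=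
          hev.mono fun w hw => by rw [Torus.lift_apply]; simp only [hw.1]
        rw [hev'.fderiv_eq]
        have h := fderiv_comp_sub (𝕜 := ℝ) (f := fun w => ρ t w ^ (1 / 3 : ℝ)) (x := z)
          (Torus.latticeVec k)
        rw [h]
        exact hb.2.trans hE
    · -- auxiliary region
      push Not at hzA
      have hev := hnearB t ht z hzA
      constructor
      · rw [partialDeriv_congr_of_eventuallyEq (hev.mono fun w hw => hw.2) i]
        exact ((hCu i t (hIco ht) _).trans ((le_abs_self _).trans (hCauxi i).1)).trans haux
      · rw [partialDeriv_congr_of_eventuallyEq (f := fun y => ρg t y ^ (1 / 3 : ℝ))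
          (g := fun y => ρ' t y ^ (1 / 3 : ℝ)) (hev.mono fun w hw => by simp only [hw.1]) i]
        have h := hCs i t (hIco ht) (Torus.proj z)
        rw [Real.norm_eq_abs] at h
        exact (h.trans ((le_abs_self _).trans (hCauxi i).2)).trans haux
  · ---------------------------------------------------------------- all orders
    intro n _
    -- exact part, uniform over orders `≤ n` on the unit ball
    have hD10 := fun n => exactSolution_iteratedFDeriv_le (T := T) hr0 hU hS hode hlimU hlimS hUb hSb hu hσ hT n
    obtain ⟨C, p, hC0, hp0, hCp⟩ := exists_uniform_exact_bounds hT1 hD10 n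
    -- auxiliary part
    obtain ⟨Caρ, hCaρ⟩ := exists_bound_iteratedFDeriv_lift hSτ hK hKS n h₂.smooth_density
    obtain ⟨Cau, hCau⟩ := exists_bound_iteratedFDeriv_lift hSτ hK hKS n h₂.smooth_velocity
    -- smoothness of the exact slices and the cube
    have hσt : ∀ t, t < T → ContDiff ℝ ∞ (σ t) := by
      intro t ht
      have hf : σ t = fun x => (r⁻¹ * (T - t) ^ (1 / r - 1)) * Sb ((T - t) ^ (-1 / r) • x) :=
        funext fun x => hσ t x
      have h2 : ContDiff ℝ ∞ fun x : V3 => Sb ((T - t) ^ (-1 / r) • x) :=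
        hSb'.comp (contDiff_const_smul _)
      rw [hf]
      exact contDiff_const.mul h2
    have hρf : ∀ t, ρ t = fun y => (1 / 27 : ℝ) • (σ t y * σ t y * σ t y) := by
      intro t; funext y; rw [hρ t y, smul_eq_mul]; ring
    obtain ⟨Cn, hCn⟩ : ∃ Cn : ℝ, Cn = 1 / 27 * (2 ^ n * (2 ^ n * C * C) * C) + C + |Caρ| + |Cau| :=
      ⟨_, rfl⟩
    have hCn0 : 0 ≤ Cn := by rw [hCn]; positivity
    refine ⟨Cn, 3 * p, fun t ht y => ?_⟩
    have hl0 : 0 < T - t := sub_pos.2 ht.2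
    have hl1 : T - t ≤ 1 := by linarith [ht.1]
    have hge1 : 1 ≤ (T - t) ^ (-(3 * p)) :=
      Real.one_le_rpow_of_pos_of_le_one_of_nonpos hl0 hl1 (by linarith)
    have hpow3 : ((T - t) ^ (-p)) ^ 3 = (T - t) ^ (-(3 * p)) := by
      rw [← Real.rpow_natCast, ← Real.rpow_mul hl0.le]; norm_num; ring_nf
    have hmono1 : (T - t) ^ (-p) ≤ (T - t) ^ (-(3 * p)) :=
      Real.rpow_le_rpow_of_exponent_ge hl0 hl1 (by linarith)
    by_cases hyA : ∃ k : Fin 3 → ℤ, ‖y - Torus.latticeVec k‖ < 14 / 64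
    · obtain ⟨k, hk⟩ := hyA
      have hev := hnearA t y k hk
      have hw1 : ‖y - Torus.latticeVec k‖ ≤ 1 := by linarith
      -- derivatives of the exact fields at `w = y - k`
      have hbσ : ∀ i, i ≤ n → ‖iteratedFDeriv ℝ i (σ t) (y - Torus.latticeVec k)‖ ≤ C * (T - t) ^ (-p) :=
        fun i hi => (hCp i hi t ht _ hw1).2
      have hbρ : ‖iteratedFDeriv ℝ n (ρ t) (y - Torus.latticeVec k)‖ ≤
          1 / 27 * (2 ^ n * (2 ^ n * C * C) * C) * (T - t) ^ (-(3 * p)) := by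
        have hs := hσt t ht.2
        have h2 := norm_iteratedFDeriv_mul_le_of_le hs hs hbσ hbσ
        have h3 := norm_iteratedFDeriv_mul_le_of_le (hs.mul hs) hs h2 hbσ n le_rfl
        have hs3 : ContDiff ℝ ∞ fun y => σ t y * σ t y * σ t y := (hs.mul hs).mul hs
        rw [hρf t, iteratedFDeriv_const_smul_apply' (hs3.contDiffAt.of_le (by exact_mod_cast le_top)),
          norm_smul, Real.norm_eq_abs, abs_of_pos (by norm_num : (0 : ℝ) < 1 / 27)]
        refine (mul_le_mul_of_nonneg_left h3 (by norm_num)).trans (le_of_eq ?_)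
        rw [← hpow3]; ring
      constructor
      · have hev' : Torus.lift (ρg t) =ᶠ[𝓝 y] fun w => ρ t (w - Torus.latticeVec k) :=
          hev.mono fun w hw => by rw [Torus.lift_apply]; exact hw.1
        rw [(hev'.iteratedFDeriv ℝ n).eq_of_nhds, iteratedFDeriv_comp_sub]
        refine hbρ.trans ?_
        rw [hCn]
        have : 0 ≤ (C + |Caρ| + |Cau|) * (T - t) ^ (-(3 * p)) := by positivity
        nlinarith [this]
      · have hev' : Torus.lift (ug t) =ᶠ[𝓝 y] fun w => u t (w - Torus.latticeVec k) :=
          hev.mono fun w hw => by rw [Torus.lift_apply]; exact hw.2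
        rw [(hev'.iteratedFDeriv ℝ n).eq_of_nhds, iteratedFDeriv_comp_sub]
        refine ((hCp n le_rfl t ht _ hw1).1.trans (mul_le_mul_of_nonneg_left hmono1 hC0)).trans ?_
        rw [hCn]
        have : 0 ≤ (1 / 27 * (2 ^ n * (2 ^ n * C * C) * C) + |Caρ| + |Cau|) * (T - t) ^ (-(3 * p)) := by
          positivity
        nlinarith [this]
    · push Not at hyA
      have hev := hnearB t ht y hyA
      have hCn_ge : ∀ {a : ℝ}, a ≤ |Caρ| + |Cau| → a ≤ Cn * (T - t) ^ (-(3 * p)) := by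
        intro a ha
        have h1 : |Caρ| + |Cau| ≤ Cn := by
          have h0 : 0 ≤ 1 / 27 * (2 ^ n * (2 ^ n * C * C) * C) := by positivity
          rw [hCn]; linarith
        calc a ≤ Cn := ha.trans h1
          _ = Cn * 1 := (mul_one _).symm
          _ ≤ Cn * (T - t) ^ (-(3 * p)) := mul_le_mul_of_nonneg_left hge1 hCn0
      constructor
      · have hev' : Torus.lift (ρg t) =ᶠ[𝓝 y] Torus.lift (ρ' t) :=
          hev.mono fun w hw => by rw [Torus.lift_apply, Torus.lift_apply]; exact hw.1
        rw [(hev'.iteratedFDeriv ℝ n).eq_of_nhds]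
        exact hCn_ge (((hCaρ t (hIco ht) y).trans (le_abs_self _)).trans (le_add_of_nonneg_right (abs_nonneg _)))
      · have hev' : Torus.lift (ug t) =ᶠ[𝓝 y] Torus.lift (u' t) :=
          hev.mono fun w hw => by rw [Torus.lift_apply, Torus.lift_apply]; exact hw.2
        rw [(hev'.iteratedFDeriv ℝ n).eq_of_nhds]
        exact hCn_ge (((hCau t (hIco ht) y).trans (le_abs_self _)).trans (le_add_of_nonneg_left (abs_nonneg _)))
  · ---------------------------------------------------------------- floor
    obtain ⟨cE, hcE, hcEσ⟩ := exactSolution_soundSpeed_lower (T := T) hr1 hr2 hU hS hode hSpos hlimU hlimS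
      hSb hσ hT (L := 1) one_pos
    -- the auxiliary density is bounded below on `[0, T] × 𝕋³`
    have hinv : Torus.IsSmoothSpaceTimeOn (Ico 0 τ) (fun t y => (ρ' t y)⁻¹) := by
      have hd : ContDiffOn ℝ ∞ (Torus.stLift ρ') (Ico 0 τ ×ˢ univ) := h₂.smooth_density
      have h := hd.inv fun q hq => (h₂.density_pos q.1 hq.1 _).ne'
      exact h
    obtain ⟨Ci, hCi⟩ := hinv.exists_norm_le_of_isCompact hK hKS
    have hCi1 : 0 < max Ci 1 := lt_max_of_lt_right one_pos
    have haux : ∀ t ∈ Ico 0 T, ∀ x, 1 / max Ci 1 ≤ ρ' t x := by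
      intro t ht x
      have hp : 0 < ρ' t x := h₂.density_pos t (hIcoτ ht) x
      have h1 : (ρ' t x)⁻¹ ≤ max Ci 1 := by
        have h := hCi t (hIco ht) x
        rw [Real.norm_eq_abs, abs_of_pos (inv_pos.2 hp)] at h
        exact h.trans (le_max_left _ _)
      rw [div_le_iff₀ hCi1]
      calc 1 = (ρ' t x)⁻¹ * ρ' t x := (inv_mul_cancel₀ hp.ne').symm
        _ ≤ max Ci 1 * ρ' t x := mul_le_mul_of_nonneg_right h1 hp.le
        _ = ρ' t x * max Ci 1 := mul_comm _ _
    refine ⟨min ((cE / 3) ^ 3) (1 / max Ci 1), 0, lt_min (by positivity) (by positivity),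
      fun t ht x => ?_⟩
    rw [Real.rpow_zero, mul_one]
    obtain ⟨z, rfl⟩ := Torus.proj_surjective x
    by_cases hzA : ∃ k : Fin 3 → ℤ, ‖z - Torus.latticeVec k‖ < 14 / 64
    · obtain ⟨k, hk⟩ := hzA
      have h1 := (hinA t z ⟨k, hk⟩).1
      rw [hround hk] at h1
      rw [h1, hρ]
      have hw1 : ‖z - Torus.latticeVec k‖ ≤ 1 := by linarith
      have h3 : cE / 3 ≤ σ t (z - Torus.latticeVec k) / 3 := by linarith [hcEσ t ht _ hw1]
      exact (min_le_left _ _).trans (pow_le_pow_left₀ (by positivity) h3 3)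
    · push Not at hzA
      rw [(hout t z hzA).1]
      exact (min_le_right _ _).trans (haux t ht _)
  · ---------------------------------------------------------------- core
    refine ⟨(S 0 / (3 * r)) ^ 3, pow_pos (div_pos (hSpos 0 le_rfl) (by positivity)) 3,
      fun t ht => ⟨Torus.proj 0, le_of_eq ?_⟩⟩
    have h0 : ‖(0 : V3) - Torus.latticeVec (0 : Fin 3 → ℤ)‖ < 14 / 64 := by
      rw [Torus.latticeVec_zero, sub_zero, norm_zero]; norm_num
    have h1 := (hinA t 0 ⟨0, h0⟩).1
    rw [hround h0, Torus.latticeVec_zero, sub_zero] at h1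
    rw [h1]
    exact (hcore t ht.2).symm

end Rates

/-! ### Main theorem -/

section Main

/-- **The periodic implosion with its rates, from the profile and a quantitative local
existence theorem** (Cao-Labora–Gómez-Serrano–Shi–Staffilani, Thm 1.2 + Rem 1.4 + Rem 1.5, in the
Euler case, via "finite speed of propagation" from the Euclidean self-similar solution of
Buckmaster–Cao-Labora–Gómez-Serrano): the named fact `CaolaboraEtAl2025_thm12_rates` follows from
the named profile fact `BuckmasterCaolaboraGomezserrano2025_thm11_monatomic` and the local existence
of classical isentropic solutions on `𝕋³` from smooth data with an existence time depending only
on `C⁴` bounds of the data and a density floor (Majda 1984, Ch. 2, Thm 2.1 — "`T` depends on `s`,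
`‖u₀‖_s` and `G₁`" — with Cor. 1, `C^∞` persistence; here a HYPOTHESIS, stated in the tree's
vocabulary). [cite: CaolaboraEtAl2025, Thm 1.2 p. 6, Rem 1.4 p. 6, Rem 1.5 p. 7]
[cite: BuckmasterCaolaboraGomezserrano2025, Thm 1.1 p. 4] [cite: Majda1984, Ch. 2 Thm 2.1 + Cor. 1]
[cite: Dafermos2005, §5.2, Thm 5.2.1] -/
theorem rates_of_thm11_monatomic_of_lwp (hX : BuckmasterCaolaboraGomezserrano2025_thm11_monatomic)
    (hLWP : ∀ (B m : ℝ), 0 < m → ∃ τ : ℝ, 0 < τ ∧ ∀ (ρ₀ : T3 → ℝ) (u₀ : T3 → V3),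
      Torus.IsSmooth ρ₀ → Torus.IsSmooth u₀ → (∀ x, m ≤ ρ₀ x) →
      (∀ n : ℕ, n ≤ 4 → ∀ y : V3, ‖iteratedFDeriv ℝ n (Torus.lift ρ₀) y‖ ≤ B ∧
        ‖iteratedFDeriv ℝ n (Torus.lift u₀) y‖ ≤ B) →
      ∃ (ρ : ℝ → T3 → ℝ) (u : ℝ → T3 → V3),
        IsIsentropicEulerSolution (5 / 3) τ ρ u ∧ ρ 0 = ρ₀ ∧ u 0 = u₀) :
    CaolaboraEtAl2025_thm12_rates := by
  obtain ⟨r, hr1', hr2', U, S, hU, hS, hode, hSpos, hlimU, hlimS⟩ := hX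
  have hr1 : 1 < r := by linarith
  have hr2 : r < 2 := by linarith
  have hr0 : 0 < r := by linarith
  set Ub : V3 → V3 := fun y => (U ‖y‖ / ‖y‖) • y with hUb
  set Sb : V3 → ℝ := fun y => S ‖y‖ with hSb
  -- `T`-uniform constants
  obtain ⟨M, hM0, hM⟩ := lift_eq_exact_on_cone_uniform hr1 hU hS hode hSpos hlimU hlimS hUb hSb
  obtain ⟨T₁, B, m, hT₁, hm, hD⟩ := exists_auxData hr1 hr2 hU hS hode hSpos hlimU hlimS hUb hSb
  obtain ⟨τ, hτ, hL⟩ := hLWP B m hm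
  -- the blow-up time
  obtain ⟨T, hTdef⟩ : ∃ T : ℝ, T = min (min T₁ (τ / 2)) (min 1 ((1 / (64 * (M + 1))) ^ r)) := ⟨_, rfl⟩
  have hT : 0 < T := by
    rw [hTdef]
    exact lt_min (lt_min hT₁ (half_pos hτ)) (lt_min one_pos (Real.rpow_pos_of_pos (by positivity) _))
  have hTT₁ : T ≤ T₁ := by rw [hTdef]; exact (min_le_left _ _).trans (min_le_left _ _)
  have hTτ : T < τ := by
    have : T ≤ τ / 2 := by rw [hTdef]; exact (min_le_left _ _).trans (min_le_right _ _)
    linarith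
  have hT1 : T ≤ 1 := by rw [hTdef]; exact (min_le_right _ _).trans (min_le_left _ _)
  have hMT : M * T ^ (1 / r) ≤ 1 / 64 := by
    have h0 : T ≤ (1 / (64 * (M + 1))) ^ r := by
      rw [hTdef]; exact (min_le_right _ _).trans (min_le_right _ _)
    have h1 : T ^ (1 / r) ≤ 1 / (64 * (M + 1)) := by
      have h := Real.rpow_le_rpow hT.le h0 (by positivity : (0 : ℝ) ≤ 1 / r)
      rw [one_div r, Real.rpow_rpow_inv (by positivity) hr0.ne'] at h
      rwa [one_div r]
    calc M * T ^ (1 / r) ≤ M * (1 / (64 * (M + 1))) := mul_le_mul_of_nonneg_left h1 hM0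
      _ ≤ 1 / 64 := by
          rw [mul_one_div, div_le_div_iff₀ (by positivity) (by norm_num)]
          nlinarith
  -- the exact solution with this blow-up time
  set u : ℝ → V3 → V3 := fun t x => (r⁻¹ * (T - t) ^ (1 / r - 1)) • Ub ((T - t) ^ (-1 / r) • x)
    with hu
  set σ : ℝ → V3 → ℝ := fun t x => (r⁻¹ * (T - t) ^ (1 / r - 1)) * Sb ((T - t) ^ (-1 / r) • x)
    with hσ
  set ρ : ℝ → V3 → ℝ := fun t x => (σ t x / 3) ^ 3 with hρ
  obtain ⟨Dρ, Du, hDρs, hDus, hDρp, hDup, hagree, hfloor, hbd⟩ :=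
    hD T u σ ρ hT hTT₁ (fun _ _ => rfl) (fun _ _ => rfl) (fun _ _ => rfl)
  -- the auxiliary periodic solution
  set ρ₀ : T3 → ℝ := Torus.descend Dρ hDρp with hρ₀
  set u₀ : T3 → V3 := Torus.descend Du hDup with hu₀
  have hl1 : Torus.lift ρ₀ = Dρ := Torus.lift_descend_holds _ _
  have hl2 : Torus.lift u₀ = Du := Torus.lift_descend_holds _ _
  have hρ₀s : Torus.IsSmooth ρ₀ := by change ContDiff ℝ ∞ (Torus.lift ρ₀); rw [hl1]; exact hDρs
  have hu₀s : Torus.IsSmooth u₀ := by change ContDiff ℝ ∞ (Torus.lift u₀); rw [hl2]; exact hDus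
  have hρ₀m : ∀ x, m ≤ ρ₀ x := fun x => by rw [hρ₀, Torus.descend_apply]; exact hfloor _
  have hbd' : ∀ n : ℕ, n ≤ 4 → ∀ y : V3, ‖iteratedFDeriv ℝ n (Torus.lift ρ₀) y‖ ≤ B ∧
      ‖iteratedFDeriv ℝ n (Torus.lift u₀) y‖ ≤ B := by
    rw [hl1, hl2]; exact hbd
  obtain ⟨ρ', u', h₂, hρ'0, hu'0⟩ := hL ρ₀ u₀ hρ₀s hu₀s hρ₀m hbd'
  have hdata : ∀ y : V3, 1 / 8 ≤ ‖y‖ → ‖y‖ ≤ 1 / 4 →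
      ρ' 0 (Torus.proj y) = ρ 0 y ∧ u' 0 (Torus.proj y) = u 0 y := by
    intro y h1 h2
    rw [hρ'0, hu'0, hρ₀, hu₀, IsentropicEuler.descend_proj, IsentropicEuler.descend_proj]
    exact hagree y h1 h2
  -- identification on the annulus, then the glued solution with its rates
  have hid := ident_annulus hM0 (hM T u σ ρ (fun _ _ => rfl) (fun _ _ => rfl) (fun _ _ => rfl))
    hMT h₂ hdata
  have hid' : ∀ t ∈ Ico 0 T, ∀ y : V3, 9 / 64 < ‖y‖ → ‖y‖ < 15 / 64 →
      ρ' t (Torus.proj y) = ρ t y ∧ u' t (Torus.proj y) = u t y :=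
    fun t ht y h1 h2 => hid ⟨ht.1, ht.2.trans hTτ⟩ ht.2 y h1 h2
  obtain ⟨ρg, ug, hsol, h2c, h3c, h4c, h5c⟩ := rates_of_glue hr1 hr2 hU hS hode hSpos hlimU hlimS
    hUb hSb hT hT1 (fun _ _ => rfl) (fun _ _ => rfl) (fun _ _ => rfl) hTτ h₂ hid'
  exact ⟨T, r, hT, hr1, ρg, ug, hsol, h2c, h3c, h4c, h5c⟩

end Main



end CaolaboraEtAl2025

end Literature.Analysis.FluidPDE
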